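import Literature.MathematicalPhysics.KineticTheory.RiemannLocalGibbsLawProofs
import Literature.Analysis.FunctionSpaces.PoissonMeckeProofs
import Literature.MathematicalPhysics.StatisticalMechanics.DiluteHardSphereGas
import Literature.MathematicalPhysics.KineticTheory.HardSphereEulerProofs
import Literature.Analysis.FunctionSpaces.PoissonMappingHomeomorph
import HarnessLib

/-!
# The dilute hard-sphere gas: proofs

Topic `Literature/MathematicalPhysics/StatisticalMechanics`; PROOFS towards the discharge of the
named fact `RuelleDiluteHardSphereGas` (`DiluteHardSphereGas.lean`).

## Part I — the Janossy (exponential) formula of a finite Poisson process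

For a Poisson point process `P` (Kingman's axioms, `IsPoissonPointProcess ν P`) on a second
countable Hausdorff Borel space with a FINITE atomless intensity `ν`, the law of the whole
configuration is

  `P(B) = e^{-ν(E)} ∑ₖ (1/k!) ∫_{Eᵏ} 𝟙_B({x₁,…,x_k}) ν^{⊗k}(dx)`

(Last–Penrose 2017, Prop. 3.5 / (4.20): conditionally on `N(E) = k` the points are `k` i.i.d.
`ν/ν(E)` points; Ruelle 1969 §1.2.1 (2.9): the grand-canonical weights `zⁿ/n!`).  Proof from the
tree's PROVED multivariate Mecke equation (`IsPoissonPointProcess.lintegral_tsum_injective_eq`)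
applied to `h(x, c) = 𝟙_{B ∩ {N = k}}(c)`: the left side counts the `k!` injective `k`-tuples of a
`k`-point configuration, the right side is `𝟙_B({x}) · P(N((range x)ᶜ) = 0) = e^{-ν(E)} 𝟙_B({x})`
for injective `x` (void probability), and non-injective tuples are `ν^{⊗k}`-null.

## References

* G. Last, M. Penrose, *Lectures on the Poisson Process* (2017), Prop. 3.5, Thm 4.4.
* D. Ruelle, *Statistical Mechanics: Rigorous Results* (1969), §1.2.1 (2.9)–(2.11), §4.2.
-/

noncomputable section

open MeasureTheory ProbabilityTheory Set Filter Function
open scoped ENNReal NNReal Topology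

namespace Literature.Analysis.FunctionSpaces

/-! ### Counting injective tuples; non-injective tuples are null -/

namespace PointConfig

variable {E : Type*} [TopologicalSpace E]

/-- `∅ ∪ c = c` for configurations. [folklore] -/
@[simp] theorem empty_union_eq (c : PointConfig E) : (∅ : PointConfig E) ∪ c = c :=
  PointConfig.ext fun x => by simp [PointConfig.mem_union, show x ∉ (∅ : PointConfig E) from
    fun h => by simp [← PointConfig.mem_carrier] at h]

/-- The number of points of `PointConfig.ofFn x` for an injective `x : Fin k → E` is `k`.
[folklore] -/
theorem count_univ_ofFn_of_injective {k : ℕ} {x : Fin k → E} (hx : Injective x) :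
    (PointConfig.ofFn x).count univ = k := by
  classical
  have h1 : (PointConfig.ofFn x).count univ = (range x).encard := by simp [PointConfig.count]
  rw [h1, ← Set.image_univ, ← Finset.coe_univ, ← Finset.coe_image, Set.encard_coe_eq_coe_finsetCard,
    Finset.card_image_of_injective _ hx, Finset.card_univ, Fintype.card_fin]

/-- **A `k`-point configuration has exactly `k!` injective `k`-tuples of its points** (they are the
bijections `Fin k → c`). [folklore] -/
theorem tsum_one_injective_eq_factorial (c : PointConfig E) {k : ℕ} (hc : c.count univ = k) :
    ∑' _ : {x : Fin k → E // Injective x ∧ ∀ i, x i ∈ c}, (1 : ℝ≥0∞) = (k.factorial : ℝ≥0∞) := by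
  classical
  have hck : (c : Set E).encard = k := by simpa [PointConfig.count] using hc
  have hfin : (c : Set E).Finite := finite_of_encard_eq_coe hck
  haveI : Fintype (c : Set E) := hfin.fintype
  have hcard : Fintype.card (c : Set E) = k := by
    rw [Set.encard_eq_coe_toFinset_card, Set.toFinset_card] at hck
    exact_mod_cast hck
  let e : {x : Fin k → E // Injective x ∧ ∀ i, x i ∈ c} ≃ (Fin k ↪ (c : Set E)) :=
    { toFun := fun x => ⟨fun i => ⟨x.1 i, x.2.2 i⟩, fun i j h => x.2.1 (congrArg Subtype.val h)⟩
      invFun := fun f => ⟨fun i => (f i : E), Subtype.val_injective.comp f.injective, fun i => (f i).2⟩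
      left_inv := fun x => by ext; rfl
      right_inv := fun f => by ext; rfl }
  rw [ENNReal.tsum_one, ENat.card_congr e, ENat.card_eq_coe_fintype_card, Fintype.card_embedding_eq,
    Fintype.card_fin, hcard, Nat.descFactorial_self]
  rfl

/-- The configuration `{x₁, …, x_k}` as a measurable function of the tuple `x` (from the tree's
joint measurability of `(x, c) ↦ c ∪ {x₁,…,x_k}` at `c = ∅`). [folklore] -/
theorem measurable_ofFn [T2Space E] [SecondCountableTopology E] [MeasurableSpace E] [BorelSpace E]
    (k : ℕ) : Measurable (PointConfig.ofFn : (Fin k → E) → PointConfig E) := by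
  have h := (PointConfig.measurable_union_ofFn (E := E) k).comp
    (measurable_id.prodMk (measurable_const (a := (∅ : PointConfig E))))
  simpa [Function.comp_def] using h

end PointConfig

/-- **Non-injective tuples are null** for the product of an atomless σ-finite measure: the
coincidence sets `{x | x i = x j}`, `i ≠ j`, are hyperplanes in the coordinate `i` once `x j` is
fixed (Fubini, `Measure.pi_hyperplane`). [folklore] -/
theorem Measure.pi_setOf_not_injective {E : Type*} [MeasurableSpace E] [MeasurableEq E]
    (ν : Measure E) [SigmaFinite ν] [NullSingletonClass ν] (k : ℕ) :
    Measure.pi (fun _ : Fin k => ν) {x : Fin k → E | ¬ Injective x} = 0 := by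
  have hset : {x : Fin k → E | ¬ Injective x} = ⋃ i : Fin k, ⋃ j : Fin k, ⋃ (_ : i ≠ j),
      {x | x i = x j} := by
    ext x
    simp only [Injective, not_forall, mem_setOf_eq, mem_iUnion, exists_prop]
    constructor
    · rintro ⟨i, j, h, hij⟩; exact ⟨i, j, hij, h⟩
    · rintro ⟨i, j, hij, h⟩; exact ⟨i, j, h, hij⟩
  rw [hset]
  refine (measure_iUnion_null_iff.2 fun i => measure_iUnion_null_iff.2 fun j =>
    measure_iUnion_null_iff.2 fun hij => ?_)
  -- split off the coordinate `j`
  cases k with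
  | zero => exact i.elim0
  | succ n =>
    obtain ⟨l, hl⟩ := Fin.exists_succAbove_eq hij
    have hmp := measurePreserving_piFinSuccAbove (fun _ : Fin (n + 1) => ν) j
    have hS : MeasurableSet {p : E × (Fin n → E) | p.2 l = p.1} :=
      measurableSet_eq_fun ((measurable_pi_apply l).comp measurable_snd) measurable_fst
    have hpre : {x : Fin (n + 1) → E | x i = x j} =
        MeasurableEquiv.piFinSuccAbove (fun _ => E) j ⁻¹' {p : E × (Fin n → E) | p.2 l = p.1} := by
      ext x
      rw [← hl]
      exact Iff.rfl
    rw [hpre, hmp.measure_preimage hS.nullMeasurableSet, Measure.prod_apply hS]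
    refine (lintegral_eq_zero_iff (measurable_measure_prodMk_left hS)).2 (Eventually.of_forall fun a => ?_)
    change Measure.pi (fun _ : Fin n => ν) (Prod.mk a ⁻¹' {p : E × (Fin n → E) | p.2 l = p.1}) = 0
    have : Prod.mk a ⁻¹' {p : E × (Fin n → E) | p.2 l = p.1} = {y | y l = a} := by
      ext y; simp
    rw [this]
    exact Measure.pi_hyperplane (fun _ : Fin n => ν) l a

namespace IsPoissonPointProcess

variable {E : Type*} [TopologicalSpace E] [T2Space E] [SecondCountableTopology E] [MeasurableSpace E]
  [BorelSpace E] {ν : Measure E} {P : Measure (PointConfig E)}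

omit [T2Space E] [SecondCountableTopology E] [MeasurableSpace E] [BorelSpace E] in
/-- Inserting an injective `k`-tuple `x` into a configuration `c` gives a `k`-point configuration in
`B` iff `c` has no point off `range x` and `{x₁,…,x_k} ∈ B`. [folklore] -/
theorem union_ofFn_mem_inter_count_iff {k : ℕ} {x : Fin k → E} (hx : Injective x)
    (c : PointConfig E) (B : Set (PointConfig E)) :
    c ∪ PointConfig.ofFn x ∈ B ∩ {c : PointConfig E | c.count univ = k} ↔
      c.count (range x)ᶜ = 0 ∧ PointConfig.ofFn x ∈ B := by
  have hfin : (range x).Finite := finite_range x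
  have hk : (range x).encard = k := by
    have := PointConfig.count_univ_ofFn_of_injective hx
    rwa [PointConfig.count, inter_univ, PointConfig.carrier_ofFn] at this
  have hsub_iff : c.count (range x)ᶜ = 0 ↔ (c : Set E) ⊆ range x := by
    rw [PointConfig.count, encard_eq_zero, ← Set.disjoint_iff_inter_eq_empty, Set.disjoint_compl_right_iff_subset]
    rfl
  have hunion : (c : Set E) ⊆ range x → c ∪ PointConfig.ofFn x = PointConfig.ofFn x := fun h =>
    PointConfig.ext fun y => by
      simp only [PointConfig.mem_union, PointConfig.mem_ofFn]
      exact ⟨fun hy => hy.elim (fun hy => h hy) id, Or.inr⟩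
  constructor
  · rintro ⟨hB, hN⟩
    have hsub : (c : Set E) ⊆ range x := by
      have hcarr : ((c ∪ PointConfig.ofFn x : PointConfig E) : Set E) = (c : Set E) ∪ range x := rfl
      have hN' : ((c : Set E) ∪ range x).encard = k := by
        rw [mem_setOf_eq, PointConfig.count, inter_univ] at hN
        exact hN
      have heq : range x = (c : Set E) ∪ range x :=
        hfin.eq_of_subset_of_encard_le subset_union_right (by rw [hN', hk])
      exact fun y hy => heq.symm ▸ (Or.inl hy : y ∈ (c : Set E) ∪ range x)
    refine ⟨hsub_iff.2 hsub, ?_⟩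
    rwa [hunion hsub] at hB
  · rintro ⟨hN, hB⟩
    have hsub := hsub_iff.1 hN
    rw [hunion hsub]
    exact ⟨hB, PointConfig.count_univ_ofFn_of_injective hx⟩

/-- **The Janossy formula on the layer `{N(E) = k}`**: for a Poisson process with finite atomless
intensity `ν` and measurable `B`,
`P(B ∩ {N(E) = k}) = e^{-ν(E)} (k!)⁻¹ ∫ 𝟙_B({x₁,…,x_k}) ν^{⊗k}(dx)` (Last–Penrose 2017, Prop. 3.5 and
Thm 4.4 with `h = 𝟙_{B ∩ {N = k}}`). [cite: LastPenrose2017, Prop. 3.5] -/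
theorem measure_inter_count_univ_eq (h : IsPoissonPointProcess ν P) [IsFiniteMeasure ν]
    (h0 : ∀ x, ν {x} = 0) {B : Set (PointConfig E)} (hB : MeasurableSet B) (k : ℕ) :
    P (B ∩ {c : PointConfig E | c.count univ = k}) =
      ENNReal.ofReal (Real.exp (-(ν univ).toReal)) * (((k.factorial : ℝ≥0∞))⁻¹ *
        ∫⁻ x, B.indicator 1 (PointConfig.ofFn x) ∂(Measure.pi fun _ : Fin k => ν)) := by
  classical
  haveI := h.isProbabilityMeasure
  haveI : NullSingletonClass ν := ⟨h0⟩
  set Nk : Set (PointConfig E) := {c | c.count univ = k} with hNk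
  have hNkm : MeasurableSet Nk :=
    PointConfig.measurable_count MeasurableSet.univ (measurableSet_singleton (k : ℕ∞))
  have hBN : MeasurableSet (B ∩ Nk) := hB.inter hNkm
  set H : (Fin k → E) × PointConfig E → ℝ≥0∞ := fun p => (B ∩ Nk).indicator 1 p.2 with hH
  have hHm : Measurable H := (measurable_one.indicator hBN).comp measurable_snd
  have hmecke := h.lintegral_tsum_injective_eq k H hHm
  -- left-hand side: `k! · P(B ∩ {N = k})`
  have hL : ∫⁻ c, (∑' x : {x : Fin k → E // Injective x ∧ ∀ i, x i ∈ c}, H (x.1, c)) ∂P =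
      (k.factorial : ℝ≥0∞) * P (B ∩ Nk) := by
    have hpt : ∀ c : PointConfig E, (∑' x : {x : Fin k → E // Injective x ∧ ∀ i, x i ∈ c}, H (x.1, c)) =
        (B ∩ Nk).indicator (fun _ => (k.factorial : ℝ≥0∞)) c := by
      intro c
      simp only [hH]
      rw [ENNReal.tsum_const] at *
      by_cases hc : c ∈ B ∩ Nk
      · rw [indicator_of_mem hc, indicator_of_mem hc, Pi.one_apply, mul_one,
          ← mul_one ((ENat.card _ : ℝ≥0∞)), ← ENNReal.tsum_const,
          PointConfig.tsum_one_injective_eq_factorial c hc.2]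
      · rw [indicator_of_notMem hc, indicator_of_notMem hc, mul_zero]
    simp_rw [hpt]
    rw [lintegral_indicator_const hBN, mul_comm]
  -- right-hand side: `e^{-ν(E)} ∫ 𝟙_B({x}) dν^{⊗k}`
  have hvoid : ∀ x : Fin k → E, P {c : PointConfig E | c.count (range x)ᶜ = 0} =
      ENNReal.ofReal (Real.exp (-(ν univ).toReal)) := fun x => by
    have hfin : (range x).Finite := finite_range x
    have hm : MeasurableSet (range x)ᶜ := hfin.measurableSet.compl
    rw [h.measure_count_eq_zero hm (measure_ne_top _ _), measure_compl hfin.measurableSet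
      (measure_ne_top _ _), hfin.measure_zero, tsub_zero]
  have hR : ∀ x : Fin k → E, Injective x →
      ∫⁻ c, H (x, c ∪ PointConfig.ofFn x) ∂P =
        ENNReal.ofReal (Real.exp (-(ν univ).toReal)) * B.indicator 1 (PointConfig.ofFn x) := by
    intro x hx
    have hpt : ∀ c : PointConfig E, H (x, c ∪ PointConfig.ofFn x) =
        {c : PointConfig E | c.count (range x)ᶜ = 0}.indicator
          (fun _ => B.indicator (1 : PointConfig E → ℝ≥0∞) (PointConfig.ofFn x)) c := by
      intro c
      simp only [hH]
      by_cases hc : c.count (range x)ᶜ = 0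
      · rw [indicator_of_mem (show c ∈ {c : PointConfig E | c.count (range x)ᶜ = 0} from hc)]
        by_cases hBx : PointConfig.ofFn x ∈ B
        · rw [indicator_of_mem ((union_ofFn_mem_inter_count_iff hx c B).2 ⟨hc, hBx⟩),
            indicator_of_mem hBx, Pi.one_apply, Pi.one_apply]
        · rw [indicator_of_notMem hBx, indicator_of_notMem]
          exact fun hmem => hBx ((union_ofFn_mem_inter_count_iff hx c B).1 hmem).2
      · rw [indicator_of_notMem (show c ∉ {c : PointConfig E | c.count (range x)ᶜ = 0} from hc),
          indicator_of_notMem]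
        exact fun hmem => hc ((union_ofFn_mem_inter_count_iff hx c B).1 hmem).1
    have hm : MeasurableSet {c : PointConfig E | c.count (range x)ᶜ = 0} :=
      PointConfig.measurable_count (finite_range x).measurableSet.compl (measurableSet_singleton 0)
    simp_rw [hpt]
    rw [lintegral_indicator_const hm, hvoid x, mul_comm]
  have hofFn : Measurable fun x : Fin k → E => B.indicator (1 : PointConfig E → ℝ≥0∞) (PointConfig.ofFn x) :=
    (measurable_one.indicator hB).comp (PointConfig.measurable_ofFn k)
  have hR' : ∫⁻ x, ∫⁻ c, H (x, c ∪ PointConfig.ofFn x) ∂P ∂(Measure.pi fun _ : Fin k => ν) =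
      ENNReal.ofReal (Real.exp (-(ν univ).toReal)) *
        ∫⁻ x, B.indicator 1 (PointConfig.ofFn x) ∂(Measure.pi fun _ : Fin k => ν) := by
    rw [← lintegral_const_mul _ hofFn]
    refine lintegral_congr_ae ?_
    have hae : ∀ᵐ x ∂(Measure.pi fun _ : Fin k => ν), Injective x := by
      rw [ae_iff]
      exact Measure.pi_setOf_not_injective ν k
    filter_upwards [hae] with x hx
    exact hR x hx
  rw [hL, hR'] at hmecke
  have hk0 : (k.factorial : ℝ≥0∞) ≠ 0 := by exact_mod_cast k.factorial_ne_zero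
  have hktop : (k.factorial : ℝ≥0∞) ≠ ∞ := ENNReal.natCast_ne_top _
  calc P (B ∩ Nk) = (k.factorial : ℝ≥0∞)⁻¹ * ((k.factorial : ℝ≥0∞) * P (B ∩ Nk)) := by
        rw [← mul_assoc, ENNReal.inv_mul_cancel hk0 hktop, one_mul]
    _ = _ := by rw [hmecke]; ring

/-- **The Janossy (exponential) formula**: a Poisson process with finite atomless intensity `ν` on
a second countable Hausdorff space satisfies, for every measurable `B`,
`P(B) = e^{-ν(E)} ∑ₖ (k!)⁻¹ ∫ 𝟙_B({x₁,…,x_k}) ν^{⊗k}(dx)` (Last–Penrose 2017, Prop. 3.5: given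
`N(E) = k` the points are i.i.d. `ν/ν(E)`; Ruelle 1969 §1.2.1 (2.9)–(2.11)).
[cite: LastPenrose2017, Prop. 3.5] -/
theorem measure_eq_tsum_lintegral_ofFn (h : IsPoissonPointProcess ν P) [IsFiniteMeasure ν]
    (h0 : ∀ x, ν {x} = 0) {B : Set (PointConfig E)} (hB : MeasurableSet B) :
    P B = ENNReal.ofReal (Real.exp (-(ν univ).toReal)) *
      ∑' k : ℕ, ((k.factorial : ℝ≥0∞))⁻¹ *
        ∫⁻ x, B.indicator 1 (PointConfig.ofFn x) ∂(Measure.pi fun _ : Fin k => ν) := by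
  haveI := h.isProbabilityMeasure
  have hNm : ∀ n : ℕ∞, MeasurableSet {c : PointConfig E | c.count univ = n} := fun n =>
    PointConfig.measurable_count MeasurableSet.univ (measurableSet_singleton n)
  -- decompose `B` along the value of `N(E) ∈ ℕ∞`
  have hdecomp : B = ⋃ n : ℕ∞, B ∩ {c : PointConfig E | c.count univ = n} := by
    ext c; simp
  have hdisj : Pairwise (Disjoint on fun n : ℕ∞ => B ∩ {c : PointConfig E | c.count univ = n}) := by
    intro n n' hnn'
    rw [Function.onFun, Set.disjoint_left]
    rintro c ⟨-, hc⟩ ⟨-, hc'⟩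
    exact hnn' (hc.symm.trans hc')
  have htop : P (B ∩ {c : PointConfig E | c.count univ = ⊤}) = 0 := by
    refine measure_mono_null inter_subset_right ?_
    have h1 := h.count_ae_lt_top MeasurableSet.univ (measure_ne_top ν _)
    rw [ae_iff] at h1
    refine measure_mono_null (fun c hc => ?_) h1
    simp only [mem_setOf_eq] at hc ⊢
    rw [hc]; exact lt_irrefl _
  conv_lhs => rw [hdecomp]
  rw [measure_iUnion hdisj fun n => hB.inter (hNm n), tsum_enat_eq_tsum_nat htop, ← ENNReal.tsum_mul_left]
  exact tsum_congr fun k => h.measure_inter_count_univ_eq h0 hB k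

end IsPoissonPointProcess

/-- **Product of a scaled measure**: `(c μ)^{⊗ι} = c^{|ι|} μ^{⊗ι}` (both agree on rectangles).
[folklore] -/
theorem Measure.pi_const_smul {ι : Type*} [Fintype ι] {α : Type*} [MeasurableSpace α]
    (μ : Measure α) [SigmaFinite μ] (c : ℝ≥0) :
    Measure.pi (fun _ : ι => c • μ) = ((c : ℝ≥0∞) ^ Fintype.card ι) • Measure.pi (fun _ : ι => μ) := by
  refine (Measure.pi_eq fun s _ => ?_)
  rw [Measure.smul_apply, smul_eq_mul, Measure.pi_pi]
  simp only [Measure.smul_apply, ENNReal.smul_def, smul_eq_mul]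
  rw [Finset.prod_mul_distrib, Finset.prod_const, Finset.card_univ]

end Literature.Analysis.FunctionSpaces

/-! ## Part II — the two DLR formalisations of the hard-sphere gas agree

The tree carries two renderings of the finite-volume grand-canonical hard-sphere distribution
`γ_Λ(· | η)` with Maxwellian velocity marks: the explicit series
`Literature.Analysis.FluidPDE.gibbsSpec ε z β u Λ η` (`InfiniteHardSphereFlow.lean`: weights
`zᵏ/k!`, `Measure.pi` of `Leb|_Λ ⊗ M_β(v-u)dv`, hard core IN the window) and the Poisson form
`Literature.MathematicalPhysics.KineticTheory.hsLocalSpec σ ν Λ η` (`RiemannLocalGibbsLaw.lean`: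
the Poisson law of intensity `ν|_{Λ×ℝ³}` glued to `η` and conditioned on the hard core of the
WHOLE glued configuration).  For the intensity `ν = z · Leb ⊗ M_β(v-u)dv` and a hard-core
boundary condition `η` they coincide (Janossy formula of Part I; for hard-core `η` the two
hard-core events agree), so every DLR state in the sense of `IsHsLocalGibbs 1 ν` is one in the
sense of `IsHardSphereGibbs 1 z β u` (a DLR state is carried by hard-core configurations).
-/

namespace Literature.MathematicalPhysics.StatisticalMechanics

open Literature.Analysis.FunctionSpaces Literature.Analysis.FluidPDE
open Literature.MathematicalPhysics.KineticTheory
open HardSphere (Pos Phase window hardCoreSet glue poissonLaw)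

/-! ### The one-particle intensity `z · Leb ⊗ M_β(v - u) dv` in the `FluidPDE` normalisation -/

/-- The Maxwellian mark density of `maxwellPhaseMeasure` is the local Maxwellian `M_{1,u,β⁻¹}`.
[folklore] -/
theorem maxwellianBeta_sub_eq (β : ℝ) (u v : Pos) :
    maxwellianBeta β (v - u) = localMaxwellian 1 β⁻¹ u v := by
  simp [maxwellianBeta, localMaxwellian]

/-- **The Maxwellian velocity law `M_β(v-u) dv` is a probability measure** (`β > 0`). [folklore] -/
theorem isProbabilityMeasure_withDensity_maxwellianBeta {β : ℝ} (hβ : 0 < β) (u : Pos) :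
    IsProbabilityMeasure ((volume : Measure Pos).withDensity fun v => ENNReal.ofReal (maxwellianBeta β (v - u))) := by
  refine ⟨?_⟩
  rw [withDensity_apply _ MeasurableSet.univ, Measure.restrict_univ]
  simp_rw [maxwellianBeta_sub_eq]
  rw [← ofReal_integral_eq_lintegral_ofReal (integrable_localMaxwellian (inv_pos.2 hβ) u)
    (Eventually.of_forall fun v => (localMaxwellian_pos one_pos (inv_pos.2 hβ) u v).le),
    integral_localMaxwellian_one (inv_pos.2 hβ) u, ENNReal.ofReal_one]

/-- Restricting `z · Leb ⊗ M` to the window `Λ × ℝ³` gives `z · (Leb|_Λ ⊗ M) = z · maxwellPhaseMeasure β u Λ`.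
[folklore] -/
theorem restrict_window_smul_prod (z : ℝ) (M : Measure Pos) [SFinite M] (Λ : Set Pos) :
    (((Real.toNNReal z) • ((volume : Measure Pos).prod M)).restrict (window Λ)) =
      (Real.toNNReal z) • (((volume : Measure Pos).restrict Λ).prod M) := by
  rw [Measure.restrict_smul, window, ← Measure.restrict_prod_eq_prod_univ]

/-- `Leb|_Λ ⊗ M` is finite for a bounded window and a finite mark law. [folklore] -/
theorem isFiniteMeasure_restrict_prod {Λ : Set Pos} (hΛ : Bornology.IsBounded Λ) (M : Measure Pos)
    [IsFiniteMeasure M] : IsFiniteMeasure (((volume : Measure Pos).restrict Λ).prod M) := by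
  haveI : IsFiniteMeasure ((volume : Measure Pos).restrict Λ) := ⟨by
    rw [Measure.restrict_apply_univ]; exact hΛ.measure_lt_top⟩
  infer_instance

/-- `z · (Leb ⊗ M)` has no atoms. [folklore] -/
theorem smul_prod_singleton (z : ℝ) (M : Measure Pos) [SFinite M] (x : Phase) :
    ((Real.toNNReal z) • ((volume : Measure Pos).prod M)) {x} = 0 := by
  rw [Measure.smul_apply, ← singleton_prod_singleton, Measure.prod_prod]
  simp

/-- `z · (Leb ⊗ M)` charges no hyperplane `{q₁ = t}`. [folklore] -/
theorem smul_prod_setOf_fst_apply_zero (z : ℝ) (M : Measure Pos) [SFinite M] (t : ℝ) :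
    ((Real.toNNReal z) • ((volume : Measure Pos).prod M)) {y : Phase | y.1 0 = t} = 0 := by
  have h : {y : Phase | y.1 0 = t} = {q : Pos | q 0 = t} ×ˢ (univ : Set Pos) := by
    ext y; simp
  rw [h, Measure.smul_apply, Measure.prod_prod, volume_setOf_apply_zero_eq t]
  simp

/-- `z · (Leb ⊗ M)` of a window `A × ℝ³` is `z |A| M(ℝ³)`. [folklore] -/
theorem smul_prod_window (z : ℝ) (M : Measure Pos) [SFinite M] (A : Set Pos) :
    ((Real.toNNReal z) • ((volume : Measure Pos).prod M)) (window A) =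
      ENNReal.ofReal z * (volume A * M univ) := by
  rw [Measure.smul_apply, window, Measure.prod_prod]
  rfl

/-- **`z · (Leb ⊗ M)` is invariant under the spatial translations `(q, v) ↦ (q + a, v)`** (Lebesgue
measure is). [folklore] -/
theorem smul_prod_map_add (z : ℝ) (M : Measure Pos) [SFinite M] (a : Pos) :
    ((Real.toNNReal z) • ((volume : Measure Pos).prod M)).map (· + ((a, 0) : Phase)) =
      (Real.toNNReal z) • ((volume : Measure Pos).prod M) := by
  rw [Measure.map_smul, add_mk_zero_eq_prodMap, ← Measure.map_prod_map _ _ (measurable_add_const a)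
    measurable_id, (measurePreserving_add_right volume a).map_eq, Measure.map_id]

/-! ### Gluing a tuple: `superposeIn` is `glue ∘ ofFn`; the two hard-core events -/

/-- `superposeIn Λ x η = glue Λ η {x₁,…,x_k}`. [folklore] -/
theorem superposeIn_eq_glue_ofFn (Λ : Set Pos) {k : ℕ} (x : Fin k → Phase) (η : PointConfig Phase) :
    superposeIn Λ x η = glue Λ η (PointConfig.ofFn x) := by
  refine PointConfig.ext fun p => ?_
  change p ∈ (Set.range x ∩ Prod.fst ⁻¹' Λ) ∪ ((η : Set Phase) ∩ Prod.fst ⁻¹' Λᶜ) ↔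
    p ∈ ((PointConfig.ofFn x).restrict (window Λ) ∪ η.restrict (window Λ)ᶜ).carrier
  simp [PointConfig.carrier_restrict, window]

/-- For a hard-core boundary condition, the hard core IN the window of the glued configuration is
the hard core of the whole glued configuration. [folklore] -/
theorem hardCoreIn_glue_iff {σ : ℝ} {Λ : Set Pos} {η : PointConfig Phase} (hη : HardSphere.IsHardCore σ η)
    (ξ : PointConfig Phase) : HardCoreIn σ Λ (glue Λ η ξ) ↔ HardSphere.IsHardCore σ (glue Λ η ξ) := by
  constructor
  · intro h p hp q hq hpq
    by_cases hcase : p.1 ∈ Λ ∨ q.1 ∈ Λ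
    · rw [dist_eq_norm]; exact h p hp q hq hpq hcase
    · simp only [not_or] at hcase
      have hp' : p ∈ η := by
        rcases hp with hp | hp
        · exact absurd (HardSphere.mem_window.1 hp.2) hcase.1
        · exact hp.1
      have hq' : q ∈ η := by
        rcases hq with hq | hq
        · exact absurd (HardSphere.mem_window.1 hq.2) hcase.2
        · exact hq.1
      exact hη p hp' q hq' hpq
  · intro h p hp q hq hpq _
    rw [← dist_eq_norm]; exact h p hp q hq hpq

/-- The integrand of `gibbsWeight` in the glued form (hard-core boundary condition). [folklore] -/
theorem indicator_superposeIn_eq {σ : ℝ} {Λ : Set Pos} {η : PointConfig Phase} (hη : HardSphere.IsHardCore σ η)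
    (A : Set (PointConfig Phase)) {k : ℕ} (x : Fin k → Phase) :
    (A ∩ {X | HardCoreIn σ Λ X}).indicator (1 : PointConfig Phase → ℝ≥0∞) (superposeIn Λ x η) =
      (A ∩ hardCoreSet σ).indicator 1 (glue Λ η (PointConfig.ofFn x)) := by
  rw [superposeIn_eq_glue_ofFn]
  by_cases hA : glue Λ η (PointConfig.ofFn x) ∈ A
  · by_cases hH : HardSphere.IsHardCore σ (glue Λ η (PointConfig.ofFn x))
    · rw [indicator_of_mem (show glue Λ η (PointConfig.ofFn x) ∈ A ∩ {X | HardCoreIn σ Λ X} from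
          ⟨hA, (hardCoreIn_glue_iff hη _).2 hH⟩),
        indicator_of_mem (show glue Λ η (PointConfig.ofFn x) ∈ A ∩ hardCoreSet σ from ⟨hA, hH⟩)]
    · rw [indicator_of_notMem fun h => hH ((hardCoreIn_glue_iff hη _).1 h.2),
        indicator_of_notMem fun h => hH h.2]
  · rw [indicator_of_notMem fun h => hA h.1, indicator_of_notMem fun h => hA h.1]

/-! ### The window law in Janossy form and the identification of the specifications -/

section Bridge

variable {z β : ℝ} (u : Pos)

/-- **Janossy form of the glued window law.** For `ν = z · Leb ⊗ M_β(v-u)dv`, a bounded measurable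
window `Λ`, a boundary condition `η` and a measurable event `S`,
`P_{ν|Λ}(glue_η⁻¹ S) = e^{-z|Λ|} ∑ₖ (k!)⁻¹ zᵏ ∫ 𝟙_S(glue_η {x}) dπ_Λ^{⊗k}` with `π_Λ = Leb|_Λ ⊗ M_β(v-u)dv`
(`maxwellPhaseMeasure β u Λ`). [cite: LastPenrose2017, Prop. 3.5] -/
theorem poissonLaw_glue_preimage_eq_tsum (hz : 0 ≤ z) (hβ : 0 < β) {Λ : Set Pos} (hΛ : MeasurableSet Λ)
    (hb : Bornology.IsBounded Λ) (η : PointConfig Phase) {S : Set (PointConfig Phase)} (hS : MeasurableSet S) :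
    poissonLaw ((Real.toNNReal z) • maxwellPhaseMeasure β u Λ) (glue Λ η ⁻¹' S) =
      ENNReal.ofReal (Real.exp (-(z * (volume Λ).toReal))) *
        ∑' k : ℕ, ((k.factorial : ℝ≥0∞))⁻¹ * (ENNReal.ofReal z ^ k *
          ∫⁻ x, S.indicator 1 (glue Λ η (PointConfig.ofFn x)) ∂(Measure.pi fun _ : Fin k => maxwellPhaseMeasure β u Λ)) := by
  haveI := isProbabilityMeasure_withDensity_maxwellianBeta hβ u
  haveI : IsFiniteMeasure (maxwellPhaseMeasure β u Λ) := isFiniteMeasure_restrict_prod hb _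
  set m : Measure Phase := (Real.toNNReal z) • maxwellPhaseMeasure β u Λ with hm
  haveI : IsFiniteMeasure m := by rw [hm]; infer_instance
  have h0 : ∀ x, m {x} = 0 := fun x => by
    rw [hm, Measure.smul_apply, maxwellPhaseMeasure, ← singleton_prod_singleton, Measure.prod_prod]
    simp
  have hP : IsPoissonPointProcess m (poissonLaw m) := HardSphere.isPoissonPointProcess_poissonLaw m h0
  have hg : Measurable (glue Λ η) := HardSphere.measurable_glue hΛ η
  rw [hP.measure_eq_tsum_lintegral_ofFn h0 (hS.preimage hg)]
  have huniv : m univ = ENNReal.ofReal (z * (volume Λ).toReal) := by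
    rw [hm, Measure.smul_apply, maxwellPhaseMeasure, ← univ_prod_univ, Measure.prod_prod, Measure.restrict_apply_univ,
      measure_univ, mul_one, ENNReal.smul_def, smul_eq_mul, ENNReal.ofReal_mul hz,
      ENNReal.ofReal_toReal hb.measure_lt_top.ne]
    rfl
  rw [huniv, ENNReal.toReal_ofReal (mul_nonneg hz ENNReal.toReal_nonneg)]
  congr 1
  refine tsum_congr fun k => ?_
  congr 1
  rw [hm, Measure.pi_const_smul, lintegral_smul_measure, Fintype.card_fin]
  rfl

/-- **The two finite-volume hard-sphere specifications agree** for the intensity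
`ν = z · Leb ⊗ M_β(v-u)dv` and a hard-core boundary condition:
`hsLocalSpec 1 ν Λ η A = FluidPDE.gibbsSpec 1 z β u Λ η A` (bounded measurable `Λ`, measurable `A`).
[cite: Ruelle1969, §1.2.1 (2.9)–(2.12)] -/
theorem hsLocalSpec_eq_gibbsSpec (hz : 0 ≤ z) (hβ : 0 < β) {σ : ℝ} {Λ : Set Pos} (hΛ : MeasurableSet Λ)
    (hb : Bornology.IsBounded Λ) {η : PointConfig Phase} (hη : HardSphere.IsHardCore σ η)
    {A : Set (PointConfig Phase)} (hA : MeasurableSet A) :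
    hsLocalSpec σ ((Real.toNNReal z) • ((volume : Measure Pos).prod
        ((volume : Measure Pos).withDensity fun v => ENNReal.ofReal (maxwellianBeta β (v - u))))) Λ η A =
      Literature.Analysis.FluidPDE.gibbsSpec σ z β u Λ η A := by
  haveI := isProbabilityMeasure_withDensity_maxwellianBeta hβ u
  set M : Measure Pos := (volume : Measure Pos).withDensity fun v => ENNReal.ofReal (maxwellianBeta β (v - u)) with hM
  have hH := HardSphere.measurableSet_hardCoreSet σ
  -- the series `W S = ∑ₖ zᵏ/k! ∫ 𝟙_S(glue {x}) dπ^{⊗k}`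
  set W : Set (PointConfig Phase) → ℝ≥0∞ := fun S => ∑' k : ℕ, ENNReal.ofReal (z ^ k / k.factorial) *
    ∫⁻ x, S.indicator 1 (glue Λ η (PointConfig.ofFn x)) ∂(Measure.pi fun _ : Fin k => maxwellPhaseMeasure β u Λ) with hW
  have hweight : ∀ S : Set (PointConfig Phase), gibbsWeight σ z β u Λ η S = W (S ∩ hardCoreSet σ) := fun S => by
    simp only [hW, gibbsWeight]
    refine tsum_congr fun k => ?_
    congr 1
    refine lintegral_congr fun x => ?_
    exact indicator_superposeIn_eq hη S x
  set E : ℝ≥0∞ := ENNReal.ofReal (Real.exp (-(z * (volume Λ).toReal))) with hE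
  have hE0 : E ≠ 0 := (ENNReal.ofReal_pos.2 (Real.exp_pos _)).ne'
  have hEtop : E ≠ ∞ := ENNReal.ofReal_ne_top
  have hjan : ∀ {S : Set (PointConfig Phase)}, MeasurableSet S →
      poissonLaw ((Real.toNNReal z) • maxwellPhaseMeasure β u Λ) (glue Λ η ⁻¹' S) = E * W S := fun {S} hS => by
    rw [poissonLaw_glue_preimage_eq_tsum u hz hβ hΛ hb η hS, hE, hW]
    congr 1
    refine tsum_congr fun k => ?_
    rw [← mul_assoc]
    congr 1
    rw [ENNReal.ofReal_div_of_pos (by exact_mod_cast k.factorial_pos), ENNReal.ofReal_pow hz,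
      ENNReal.ofReal_natCast, div_eq_mul_inv, mul_comm]
  have hrestr : (((Real.toNNReal z) • ((volume : Measure Pos).prod M)).restrict (window Λ)) =
      (Real.toNNReal z) • maxwellPhaseMeasure β u Λ := by
    rw [restrict_window_smul_prod]; rfl
  rw [hsLocalSpec_apply_eq _ σ hΛ η hA, hrestr, hjan hH, hjan (hA.inter hH), Literature.Analysis.FluidPDE.gibbsSpec,
    hweight, hweight, univ_inter, ENNReal.mul_inv (Or.inl hE0) (Or.inl hEtop), ENNReal.div_eq_inv_mul]
  calc E⁻¹ * (W (hardCoreSet σ))⁻¹ * (E * W (A ∩ hardCoreSet σ))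
      = (E⁻¹ * E) * ((W (hardCoreSet σ))⁻¹ * W (A ∩ hardCoreSet σ)) := by ring
    _ = (W (hardCoreSet σ))⁻¹ * W (A ∩ hardCoreSet σ) := by rw [ENNReal.inv_mul_cancel hE0 hEtop, one_mul]

/-- **DLR states for `hsLocalSpec` are DLR states for `FluidPDE.gibbsSpec`**: a solution of
`IsHsLocalGibbs σ (z · Leb ⊗ M_β(v-u)dv)` is a hard-sphere Gibbs state `IsHardSphereGibbs σ z β u`
(it is carried by hard-core configurations, on which the two specifications agree).
[cite: Georgii2011, Def. 1.23] -/
theorem isHardSphereGibbs_of_isHsLocalGibbs (hz : 0 ≤ z) (hβ : 0 < β) {σ : ℝ} {μ : Measure (PointConfig Phase)}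
    (hμ : IsHsLocalGibbs σ ((Real.toNNReal z) • ((volume : Measure Pos).prod
        ((volume : Measure Pos).withDensity fun v => ENNReal.ofReal (maxwellianBeta β (v - u))))) μ) :
    IsHardSphereGibbs σ z β u μ := by
  refine ⟨hμ.isProbabilityMeasure, fun Λ hΛ hb A hA => ?_⟩
  rw [← hμ.lintegral_hsLocalSpec hΛ hb hA]
  refine lintegral_congr_ae (hμ.ae_isHardCore.mono fun η hη => ?_)
  exact hsLocalSpec_eq_gibbsSpec u hz hβ hΛ hb hη hA

end Bridge

/-! ## Part III — velocity transport; the low-activity state; translation invariance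

The Maxwellian mark law `M_β(v-u) dv` is the image of `M_1(v) dv` under the affine homeomorphism
`v ↦ u + β^{-1/2} v`; a position-preserving homeomorphism `Φ` of phase space transports Poisson
laws (Mapping Theorem), gluing, the hard core and hence the specifications and DLR states
(`IsHsLocalGibbs.map_posPreserving`), leaving the spatial density and translation invariance
untouched.  The reference states at `(β, u) = (1, 0)` come from the tree's existence and
uniqueness theorems for `IsHsLocalGibbs` at small activity (Michelen–Perkins route), translation
invariant by uniqueness.
-/

section Velocity

/-- **The Maxwellian mark law is an affine image of the standard Gaussian**:
`M_β(v - u) dv = N(0, I) ∘ (w ↦ u + β^{-1/2} w)⁻¹` (`β > 0`). [folklore] -/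
theorem withDensity_maxwellianBeta_eq_map_stdGaussian {β : ℝ} (hβ : 0 < β) (u : Pos) :
    ((volume : Measure Pos).withDensity fun v => ENNReal.ofReal (maxwellianBeta β (v - u))) =
      (stdGaussian Pos).map (fun w => u + Real.sqrt β⁻¹ • w) := by
  haveI := isProbabilityMeasure_withDensity_maxwellianBeta hβ u
  have hθ : 0 < β⁻¹ := inv_pos.2 hβ
  refine Measure.ext fun s hs => ?_
  rw [withDensity_apply _ hs]
  have h1 : ∫⁻ v in s, ENNReal.ofReal (maxwellianBeta β (v - u)) =
      ENNReal.ofReal (∫ v, localMaxwellian 1 β⁻¹ u v • s.indicator (fun _ => (1 : ℝ)) v) := by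
    simp_rw [maxwellianBeta_sub_eq, smul_eq_mul]
    rw [← lintegral_indicator hs, ofReal_integral_eq_lintegral_ofReal]
    · congr 1
      funext v
      by_cases hv : v ∈ s <;> simp [hv]
    · exact ((integrable_localMaxwellian hθ u).mul_const 1).indicator hs |>.congr
        (Eventually.of_forall fun v => by by_cases hv : v ∈ s <;> simp [hv])
    · exact Eventually.of_forall fun v => by
        by_cases hv : v ∈ s <;> simp [hv, (localMaxwellian_pos one_pos hθ u v).le]
  rw [h1, integral_localMaxwellian_smul hθ u, ← integral_gaussMeasure u hθ (s.indicator fun _ => (1 : ℝ)),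
    show (s.indicator fun _ => (1 : ℝ)) = s.indicator 1 from rfl, integral_indicator_one hs, ofReal_measureReal]
  rfl

/-- **Velocity transport of the Maxwellian marks**: every Maxwellian mark law is the image of the
reference one `M_1(v) dv` under a homeomorphism of velocity space. [folklore] -/
theorem exists_homeomorph_map_withDensity_maxwellianBeta {β : ℝ} (hβ : 0 < β) (u : Pos) :
    ∃ φ : Pos ≃ₜ Pos, ((volume : Measure Pos).withDensity fun v => ENNReal.ofReal (maxwellianBeta 1 (v - 0))).map φ =
      (volume : Measure Pos).withDensity fun v => ENNReal.ofReal (maxwellianBeta β (v - u)) := by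
  have h1 : (0 : ℝ) < Real.sqrt (1 : ℝ)⁻¹ := Real.sqrt_pos.2 (by norm_num)
  have hb : (0 : ℝ) < Real.sqrt β⁻¹ := Real.sqrt_pos.2 (inv_pos.2 hβ)
  set φ₀ : Pos ≃ₜ Pos := (Homeomorph.smulOfNeZero (Real.sqrt (1 : ℝ)⁻¹) h1.ne').trans (Homeomorph.addLeft 0)
  set φ₁ : Pos ≃ₜ Pos := (Homeomorph.smulOfNeZero (Real.sqrt β⁻¹) hb.ne').trans (Homeomorph.addLeft u)
  refine ⟨φ₀.symm.trans φ₁, ?_⟩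
  have e0 : (⇑φ₀ : Pos → Pos) = fun w => 0 + Real.sqrt (1 : ℝ)⁻¹ • w := rfl
  have e1 : (⇑φ₁ : Pos → Pos) = fun w => u + Real.sqrt β⁻¹ • w := rfl
  rw [withDensity_maxwellianBeta_eq_map_stdGaussian one_pos, withDensity_maxwellianBeta_eq_map_stdGaussian hβ,
    ← e0, ← e1, Measure.map_map (φ₀.symm.trans φ₁).measurable φ₀.measurable]
  congr 1
  funext w
  simp

variable (Φ : Phase ≃ₜ Phase)

/-- A homeomorphism of phase space **preserving positions** preserves every window. [folklore] -/
theorem preimage_window_of_posPreserving (hΦ : ∀ p, (Φ p).1 = p.1) (Λ : Set Pos) :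
    Φ ⁻¹' window Λ = window Λ := by
  ext p; simp [hΦ p]

/-- Images commute with superposition. [folklore] -/
theorem mapHomeomorph_union (c d : PointConfig Phase) :
    (c ∪ d).mapHomeomorph Φ = c.mapHomeomorph Φ ∪ d.mapHomeomorph Φ := by
  refine PointConfig.ext fun x => ?_
  simp only [PointConfig.mem_mapHomeomorph_iff, PointConfig.mem_union]

/-- **A position-preserving homeomorphism commutes with gluing.** [folklore] -/
theorem mapHomeomorph_glue (hΦ : ∀ p, (Φ p).1 = p.1) (Λ : Set Pos) (η ξ : PointConfig Phase) :
    (glue Λ η ξ).mapHomeomorph Φ = glue Λ (η.mapHomeomorph Φ) (ξ.mapHomeomorph Φ) := by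
  rw [glue, glue, mapHomeomorph_union, PointConfig.restrict_mapHomeomorph, PointConfig.restrict_mapHomeomorph,
    Set.preimage_compl, preimage_window_of_posPreserving Φ hΦ]

/-- The hard core is invariant under position-preserving homeomorphisms. [folklore] -/
theorem isHardCore_mapHomeomorph_iff (hΦ : ∀ p, (Φ p).1 = p.1) {σ : ℝ} (c : PointConfig Phase) :
    HardSphere.IsHardCore σ (c.mapHomeomorph Φ) ↔ HardSphere.IsHardCore σ c := by
  constructor
  · intro h x hx y hy hxy
    have h' := h (Φ x) ((PointConfig.apply_mem_mapHomeomorph_iff Φ c x).2 hx) (Φ y)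
      ((PointConfig.apply_mem_mapHomeomorph_iff Φ c y).2 hy) (fun e => hxy (Φ.injective e))
    rwa [hΦ x, hΦ y] at h'
  · intro h x hx y hy hxy
    rw [PointConfig.mem_mapHomeomorph_iff] at hx hy
    have h' := h _ hx _ hy (fun e => hxy (Φ.symm.injective e))
    have ex : (Φ.symm x).1 = x.1 := by simpa using (hΦ (Φ.symm x)).symm
    have ey : (Φ.symm y).1 = y.1 := by simpa using (hΦ (Φ.symm y)).symm
    rwa [ex, ey] at h'

/-- The hard-core event is invariant under position-preserving homeomorphisms. [folklore] -/
theorem preimage_mapHomeomorph_hardCoreSet (hΦ : ∀ p, (Φ p).1 = p.1) (σ : ℝ) :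
    PointConfig.mapHomeomorph Φ ⁻¹' hardCoreSet σ = hardCoreSet σ := by
  ext c; exact isHardCore_mapHomeomorph_iff Φ hΦ c

/-- **Covariance of the Poisson law under homeomorphisms** (Mapping Theorem + Rényi uniqueness,
both proved in the tree). [cite: Kingman1993, §2.3 Mapping Theorem] -/
theorem poissonLaw_map_mapHomeomorph {ν : Measure Phase} [IsLocallyFiniteMeasure ν]
    [IsLocallyFiniteMeasure (ν.map Φ)] (h0 : ∀ x, ν {x} = 0) :
    (poissonLaw ν).map (PointConfig.mapHomeomorph Φ) = poissonLaw (ν.map Φ) := by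
  have h0' : ∀ x, ν.map Φ {x} = 0 := fun x => by
    rw [Measure.map_apply Φ.measurable (measurableSet_singleton x)]
    have : (Φ : Phase → Phase) ⁻¹' {x} = {Φ.symm x} := by
      ext y
      simp only [mem_preimage, mem_singleton_iff]
      exact Φ.toEquiv.eq_symm_apply.symm
    rw [this]; exact h0 _
  exact IsPoissonPointProcess.unique_holds ((HardSphere.isPoissonPointProcess_poissonLaw ν h0).mapHomeomorph' Φ)
    (HardSphere.isPoissonPointProcess_poissonLaw _ h0')

/-- **Covariance of the local specification under position-preserving homeomorphisms of phase
space**: `γ^{ν∘Φ⁻¹}_Λ(· | Φ η) = γ^ν_Λ(· | η) ∘ Φ⁻¹`. [cite: Georgii2011, Def. 1.23] -/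
theorem hsLocalSpec_mapHomeomorph (hΦ : ∀ p, (Φ p).1 = p.1) {σ : ℝ} {ν : Measure Phase} [IsLocallyFiniteMeasure ν]
    [IsLocallyFiniteMeasure (ν.map Φ)] (h0 : ∀ x, ν {x} = 0) {Λ : Set Pos} (hΛ : MeasurableSet Λ)
    (η : PointConfig Phase) :
    hsLocalSpec σ (ν.map Φ) Λ (η.mapHomeomorph Φ) = (hsLocalSpec σ ν Λ η).map (PointConfig.mapHomeomorph Φ) := by
  have hW : MeasurableSet (window Λ) := HardSphere.measurableSet_window hΛ
  have hS : Measurable (PointConfig.mapHomeomorph Φ : PointConfig Phase → PointConfig Phase) :=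
    PointConfig.measurable_mapHomeomorph Φ
  have hH : MeasurableSet (hardCoreSet σ) := HardSphere.measurableSet_hardCoreSet σ
  have hrestr : (ν.map Φ).restrict (window Λ) = (ν.restrict (window Λ)).map Φ := by
    rw [Measure.restrict_map Φ.measurable hW, preimage_window_of_posPreserving Φ hΦ]
  haveI : IsLocallyFiniteMeasure ((ν.restrict (window Λ)).map Φ) := by rw [← hrestr]; infer_instance
  have h0r : ∀ x, ν.restrict (window Λ) {x} = 0 := fun x =>
    nonpos_iff_eq_zero.mp ((Measure.restrict_apply_le _ _).trans_eq (h0 x))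
  have hP : poissonLaw ((ν.map Φ).restrict (window Λ)) =
      (poissonLaw (ν.restrict (window Λ))).map (PointConfig.mapHomeomorph Φ) := by
    rw [hrestr, poissonLaw_map_mapHomeomorph Φ h0r]
  have hglue : glue Λ (η.mapHomeomorph Φ) ∘ PointConfig.mapHomeomorph Φ =
      PointConfig.mapHomeomorph Φ ∘ glue Λ η :=
    funext fun ξ => (mapHomeomorph_glue Φ hΦ Λ η ξ).symm
  have hg : Measurable (glue Λ (η.mapHomeomorph Φ)) := HardSphere.measurable_glue hΛ _
  have hg' : Measurable (glue Λ η) := HardSphere.measurable_glue hΛ _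
  rw [hsLocalSpec_def, hsLocalSpec_def, hP, Measure.map_map hg hS, hglue, ← Measure.map_map hS hg',
    Measure.restrict_map hS hH, preimage_mapHomeomorph_hardCoreSet Φ hΦ, Measure.map_smul, Measure.map_apply hS
    MeasurableSet.univ, Set.preimage_univ]

/-- **DLR states are transported by position-preserving homeomorphisms of phase space**: if `μ`
solves the DLR equations for `(σ, ν)` then `μ ∘ Φ⁻¹` solves them for `(σ, ν ∘ Φ⁻¹)`.
[cite: Georgii2011, Def. 1.23] -/
theorem IsHsLocalGibbs.map_mapHomeomorph (hΦ : ∀ p, (Φ p).1 = p.1) {σ : ℝ} {ν : Measure Phase}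
    [IsLocallyFiniteMeasure ν] [IsLocallyFiniteMeasure (ν.map Φ)] (h0 : ∀ x, ν {x} = 0)
    {μ : Measure (PointConfig Phase)} (h : IsHsLocalGibbs σ ν μ) :
    IsHsLocalGibbs σ (ν.map Φ) (μ.map (PointConfig.mapHomeomorph Φ)) := by
  haveI := h.isProbabilityMeasure
  have hS : Measurable (PointConfig.mapHomeomorph Φ : PointConfig Phase → PointConfig Phase) :=
    PointConfig.measurable_mapHomeomorph Φ
  refine ⟨Measure.isProbabilityMeasure_map hS.aemeasurable, fun Λ hΛ hb A hA => ?_⟩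
  rw [← PointConfig.coe_mapHomeomorphEquiv, (PointConfig.mapHomeomorphEquiv Φ).measurableEmbedding.lintegral_map,
    PointConfig.coe_mapHomeomorphEquiv, Measure.map_apply hS hA]
  simp_rw [hsLocalSpec_mapHomeomorph Φ hΦ h0 hΛ, Measure.map_apply hS hA]
  exact h.lintegral_hsLocalSpec hΛ hb (hS hA)

/-- Position-preserving homeomorphisms do not change the count of a window. [folklore] -/
theorem count_mapHomeomorph_preimage_fst (hΦ : ∀ p, (Φ p).1 = p.1) (c : PointConfig Phase) (C : Set Pos) :
    (c.mapHomeomorph Φ).count (Prod.fst ⁻¹' C) = c.count (Prod.fst ⁻¹' C) := by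
  rw [PointConfig.count_mapHomeomorph]
  congr 1
  ext p; simp [hΦ p]

/-- **The spatial density is invariant under position-preserving homeomorphisms.** [folklore] -/
theorem density_map_mapHomeomorph (hΦ : ∀ p, (Φ p).1 = p.1) (μ : Measure (PointConfig Phase)) :
    PointProcess.density (μ.map (PointConfig.mapHomeomorph Φ)) = PointProcess.density μ := by
  have hS : Measurable (PointConfig.mapHomeomorph Φ : PointConfig Phase → PointConfig Phase) :=
    PointConfig.measurable_mapHomeomorph Φ
  have hC : MeasurableSet (Prod.fst ⁻¹' Torus.unitCube (Fin 3) : Set Phase) :=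
    measurable_fst Torus.measurableSet_unitCube
  have hf : Measurable fun ω : PointConfig Phase =>
      ((ω.count (Prod.fst ⁻¹' Torus.unitCube (Fin 3)) : ℕ∞) : ℝ≥0∞) :=
    measurable_from_top.comp (PointConfig.measurable_count hC)
  unfold PointProcess.density
  rw [lintegral_map hf hS]
  simp_rw [count_mapHomeomorph_preimage_fst Φ hΦ]

/-- Position-preserving homeomorphisms acting trivially... commute with spatial shifts when they
act fibrewise: `Φ (q, v) = (q, φ v)`. [folklore] -/
theorem mapHomeomorph_shift (φ : Pos ≃ₜ Pos) (a : Pos) (c : PointConfig Phase) :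
    (HardSphere.shift a c).mapHomeomorph ((Homeomorph.refl Pos).prodCongr φ) =
      HardSphere.shift a (c.mapHomeomorph ((Homeomorph.refl Pos).prodCongr φ)) := by
  refine PointConfig.ext fun x => ?_
  rw [PointConfig.mem_mapHomeomorph_iff, mem_shift_iff, mem_shift_iff, PointConfig.mem_mapHomeomorph_iff]
  have : ((Homeomorph.refl Pos).prodCongr φ).symm (x - ((a, 0) : Phase)) =
      ((Homeomorph.refl Pos).prodCongr φ).symm x - ((a, 0) : Phase) := by
    ext <;> simp [Homeomorph.prodCongr_symm, Prod.fst_sub, Prod.snd_sub]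
  rw [this]

/-- **Translation invariance is transported by fibrewise velocity homeomorphisms.** [folklore] -/
theorem isTranslationInvariant_map_mapHomeomorph (φ : Pos ≃ₜ Pos) {μ : Measure (PointConfig Phase)}
    (h : HardSphere.IsTranslationInvariant μ) :
    HardSphere.IsTranslationInvariant (μ.map (PointConfig.mapHomeomorph ((Homeomorph.refl Pos).prodCongr φ))) := by
  intro a
  have hS : Measurable (PointConfig.mapHomeomorph ((Homeomorph.refl Pos).prodCongr φ) :
      PointConfig Phase → PointConfig Phase) := PointConfig.measurable_mapHomeomorph _
  have hT : Measurable (HardSphere.shift a) := HardSphere.measurable_shift a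
  rw [Measure.map_map hT hS]
  have hcomm : HardSphere.shift a ∘ PointConfig.mapHomeomorph ((Homeomorph.refl Pos).prodCongr φ) =
      PointConfig.mapHomeomorph ((Homeomorph.refl Pos).prodCongr φ) ∘ HardSphere.shift a :=
    funext fun c => (mapHomeomorph_shift φ a c).symm
  rw [hcomm, ← Measure.map_map hS hT, h a]

/-- The image of `z · Leb ⊗ M` under the fibrewise homeomorphism `(q, v) ↦ (q, φ v)` is
`z · Leb ⊗ (M ∘ φ⁻¹)`. [folklore] -/
theorem smul_prod_map_prodCongr (z : ℝ) (M : Measure Pos) [SFinite M] (φ : Pos ≃ₜ Pos) :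
    ((Real.toNNReal z) • ((volume : Measure Pos).prod M)).map ((Homeomorph.refl Pos).prodCongr φ) =
      (Real.toNNReal z) • ((volume : Measure Pos).prod (M.map φ)) := by
  have hmap : (⇑((Homeomorph.refl Pos).prodCongr φ) : Phase → Phase) = Prod.map id φ := by
    funext p; rfl
  rw [Measure.map_smul, hmap, ← Measure.map_prod_map _ _ measurable_id φ.measurable, Measure.map_id]

end Velocity

section State

variable {z : ℝ}

/-- **The reference low-activity DLR state exists and is unique**: for `0 ≤ z < 1/16` the DLR
equations `IsHsLocalGibbs 1 (z · Leb ⊗ M_β(v-u)dv)` have exactly one solution (the tree's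
existence / uniqueness theorems at small activity with `κ = 8z`, `2κ < 1`).
[cite: MichelenPerkins2021, Thm 3 and Thm 25] -/
theorem existsUnique_isHsLocalGibbs (hz : 0 ≤ z) (hz1 : z < 1 / 16) {β : ℝ} (hβ : 0 < β) (u : Pos) :
    ∃! μ : Measure (PointConfig Phase), IsHsLocalGibbs 1 ((Real.toNNReal z) • ((volume : Measure Pos).prod
      ((volume : Measure Pos).withDensity fun v => ENNReal.ofReal (maxwellianBeta β (v - u))))) μ := by
  haveI := isProbabilityMeasure_withDensity_maxwellianBeta hβ u
  set M : Measure Pos := (volume : Measure Pos).withDensity fun v => ENNReal.ofReal (maxwellianBeta β (v - u)) with hM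
  set ν : Measure Phase := (Real.toNNReal z) • ((volume : Measure Pos).prod M) with hν
  haveI : IsLocallyFiniteMeasure ν := by rw [hν]; infer_instance
  have h0 : ∀ x, ν {x} = 0 := smul_prod_singleton z M
  have hm : ∀ t : ℝ, ν {y : Phase | y.1 0 = t} = 0 := smul_prod_setOf_fst_apply_zero z M
  have hκ0 : (0 : ℝ) ≤ 8 * z := by positivity
  have hvol8 : ∀ a : Pos, volume (Metric.ball a (1 : ℝ)) ≤ ENNReal.ofReal 8 := fun a =>
    (volume_ball_le a 1).trans_eq (by rw [← ENNReal.ofReal_pow (by norm_num)]; norm_num)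
  have hκ : ∀ a : Pos, ν (window (Metric.ball a 1)) ≤ ENNReal.ofReal (8 * z) := fun a => by
    rw [hν, smul_prod_window, measure_univ, mul_one, mul_comm (8 : ℝ) z, ENNReal.ofReal_mul hz]
    gcongr
    exact hvol8 a
  have hκ1 : 2 * (8 * z) < 1 := by linarith
  have hfin : ∀ R : ℝ, ν (window (Metric.ball (0 : Pos) R)) ≠ ∞ := fun R => by
    rw [hν, smul_prod_window, measure_univ, mul_one]
    exact ENNReal.mul_ne_top ENNReal.ofReal_ne_top Metric.isBounded_ball.measure_lt_top.ne
  obtain ⟨μ, hμ⟩ := exists_isHsLocalGibbs_of_small_activity ν one_pos h0 hm hκ0 hκ hκ1 hfin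
  exact ⟨μ, hμ, fun μ' hμ' => IsHsLocalGibbs.unique_of_small_activity ν one_pos h0 hm hκ0 hκ hκ1 hfin hμ' hμ⟩

/-- **The chosen low-activity state**: for `0 ≤ z < 1/16`, `β > 0`,
`hsLocalGibbsState 1 (z · Leb ⊗ M_β(v-u)dv)` is a DLR state, a hard-sphere Gibbs state in the sense
of `IsHardSphereGibbs 1 z β u`, and translation invariant. [cite: Ruelle1969, §4.2 Thm 4.2.3] -/
theorem hsLocalGibbsState_isHardSphereGibbs (hz : 0 ≤ z) (hz1 : z < 1 / 16) {β : ℝ} (hβ : 0 < β) (u : Pos) :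
    IsHsLocalGibbs 1 ((Real.toNNReal z) • ((volume : Measure Pos).prod
        ((volume : Measure Pos).withDensity fun v => ENNReal.ofReal (maxwellianBeta β (v - u)))))
      (hsLocalGibbsState 1 ((Real.toNNReal z) • ((volume : Measure Pos).prod
        ((volume : Measure Pos).withDensity fun v => ENNReal.ofReal (maxwellianBeta β (v - u)))))) ∧
    IsHardSphereGibbs 1 z β u (hsLocalGibbsState 1 ((Real.toNNReal z) • ((volume : Measure Pos).prod
        ((volume : Measure Pos).withDensity fun v => ENNReal.ofReal (maxwellianBeta β (v - u)))))) ∧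
    HardSphere.IsTranslationInvariant (hsLocalGibbsState 1 ((Real.toNNReal z) • ((volume : Measure Pos).prod
        ((volume : Measure Pos).withDensity fun v => ENNReal.ofReal (maxwellianBeta β (v - u)))))) := by
  haveI := isProbabilityMeasure_withDensity_maxwellianBeta hβ u
  set M : Measure Pos := (volume : Measure Pos).withDensity fun v => ENNReal.ofReal (maxwellianBeta β (v - u)) with hM
  have hu := existsUnique_isHsLocalGibbs hz hz1 hβ u
  have hG : IsHsLocalGibbs 1 ((Real.toNNReal z) • ((volume : Measure Pos).prod M))
      (hsLocalGibbsState 1 ((Real.toNNReal z) • ((volume : Measure Pos).prod M))) :=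
    isHsLocalGibbs_hsLocalGibbsState hu.exists
  haveI : IsLocallyFiniteMeasure ((Real.toNNReal z) • ((volume : Measure Pos).prod M)) := by infer_instance
  refine ⟨hG, isHardSphereGibbs_of_isHsLocalGibbs u hz hβ hG, fun a => ?_⟩
  exact hsLocalGibbsState_map_shift (smul_prod_singleton z M) (smul_prod_map_add z M a) hu

end State

/-! ## Part IV — the density: packing bound, layer decomposition, pinning, continuity, bounds -/

section Density

/-- The unit cube `[0,1)³` has volume `1`. [folklore] -/
theorem volume_torusUnitCube : volume (Torus.unitCube (Fin 3) : Set Pos) = 1 := by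
  have h : (Torus.unitCube (Fin 3) : Set Pos) = (WithLp.ofLp : Pos → Fin 3 → ℝ) ⁻¹' Set.pi univ fun _ => Ico (0 : ℝ) 1 := by
    ext q; simp [Torus.mem_unitCube]
  rw [h, (PiLp.volume_preserving_ofLp (Fin 3)).measure_preimage
    (MeasurableSet.univ_pi fun _ => measurableSet_Ico).nullMeasurableSet, Real.volume_pi_Ico]
  simp

/-- The unit cube lies in the ball `B(0, 2)`. [folklore] -/
theorem torusUnitCube_subset_ball : (Torus.unitCube (Fin 3) : Set Pos) ⊆ Metric.ball 0 2 := by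
  intro q hq
  rw [Torus.mem_unitCube] at hq
  rw [Metric.mem_ball, dist_zero_right, EuclideanSpace.norm_eq]
  have h3 : ∑ i : Fin 3, q i ^ 2 < 4 := by
    have hi : ∀ i : Fin 3, q i ^ 2 ≤ 1 := fun i => by
      have h1 := (hq i).1; have h2 := (hq i).2
      nlinarith
    calc ∑ i : Fin 3, q i ^ 2 ≤ ∑ _i : Fin 3, (1 : ℝ) := Finset.sum_le_sum fun i _ => hi i
      _ = 3 := by simp
      _ < 4 := by norm_num
  calc Real.sqrt (∑ i : Fin 3, ‖q i‖ ^ 2) = Real.sqrt (∑ i : Fin 3, q i ^ 2) := by simp [Real.norm_eq_abs, sq_abs]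
    _ < 2 := (Real.sqrt_lt' two_pos).2 (by norm_num; exact h3)

/-- The window `[0,1)³ × ℝ³` is measurable. [folklore] -/
theorem measurableSet_fst_preimage_unitCube :
    MeasurableSet (Prod.fst ⁻¹' (Torus.unitCube (Fin 3) : Set Pos) : Set Phase) :=
  measurable_fst Torus.measurableSet_unitCube

/-- **Packing bound**: a hard-sphere configuration (diameter `1`) has at most `8` centres in the
unit cube (two centres in the same half-cube of side `1/2` would be at distance `< √3/2 < 1`).
[folklore] -/
theorem count_unitCube_le_of_isHardCore {ω : PointConfig Phase} (hω : HardSphere.IsHardCore 1 ω) :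
    ω.count (Prod.fst ⁻¹' (Torus.unitCube (Fin 3) : Set Pos)) ≤ 8 := by
  classical
  set S : Set Phase := (ω : Set Phase) ∩ Prod.fst ⁻¹' (Torus.unitCube (Fin 3) : Set Pos) with hS
  set f : Phase → (Fin 3 → Bool) := fun p i => decide (p.1 i < 1 / 2) with hf
  have hinj : InjOn f S := by
    intro p hp q hq hpq
    by_contra hne
    have hfar : 1 ≤ dist p.1 q.1 := hω p hp.1 q hq.1 hne
    have hcoord : ∀ i : Fin 3, (p.1 i - q.1 i) ^ 2 < 1 / 4 := fun i => by
      have hpi := (Torus.mem_unitCube.1 hp.2) i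
      have hqi := (Torus.mem_unitCube.1 hq.2) i
      have hfi : (p.1 i < 1 / 2 ↔ q.1 i < 1 / 2) := by simpa [hf] using congrFun hpq i
      have hab : |p.1 i - q.1 i| < 1 / 2 := by
        rw [abs_sub_lt_iff]
        by_cases h : p.1 i < 1 / 2
        · have := hfi.1 h; constructor <;> linarith [hpi.1, hqi.1]
        · have : ¬ q.1 i < 1 / 2 := fun h' => h (hfi.2 h'); constructor <;> linarith [hpi.2, hqi.2]
      have h2 : |p.1 i - q.1 i| ^ 2 < (1 / 2) ^ 2 := by
        have h0 : 0 ≤ |p.1 i - q.1 i| := abs_nonneg _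
        nlinarith
      rw [sq_abs] at h2
      linarith
    have hsum : ∑ i : Fin 3, (p.1 i - q.1 i) ^ 2 < 1 := by
      calc ∑ i : Fin 3, (p.1 i - q.1 i) ^ 2 < ∑ _i : Fin 3, (1 / 4 : ℝ) :=
            Finset.sum_lt_sum_of_nonempty Finset.univ_nonempty fun i _ => hcoord i
        _ < 1 := by norm_num
    have hnear : dist p.1 q.1 < 1 := by
      rw [EuclideanSpace.dist_eq]
      refine (Real.sqrt_lt' one_pos).2 ?_
      simpa [Real.dist_eq, sq_abs] using hsum
    exact absurd hfar (not_le.2 hnear)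
  calc ω.count (Prod.fst ⁻¹' (Torus.unitCube (Fin 3) : Set Pos)) = S.encard := rfl
    _ = (f '' S).encard := (hinj.encard_image).symm
    _ ≤ (univ : Set (Fin 3 → Bool)).encard := encard_le_encard (subset_univ _)
    _ = 8 := by
        rw [encard_univ, ENat.card_eq_coe_fintype_card]; rfl

/-- **Layer decomposition of a bounded count**: if `N ≤ 8` then `N = ∑_{m<9} m 𝟙[N = m]`.
[folklore] -/
theorem coe_count_eq_sum_indicator {W : Set Phase} {ω : PointConfig Phase} (h : ω.count W ≤ 8) :
    ((ω.count W : ℕ∞) : ℝ≥0∞) =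
      ∑ m ∈ Finset.range 9, ({c : PointConfig Phase | c.count W = m}).indicator (fun _ => (m : ℝ≥0∞)) ω := by
  obtain ⟨n, hn⟩ : ∃ n : ℕ, ω.count W = n :=
    Option.ne_none_iff_exists'.1 (ne_top_of_le_ne_top (by decide) h)
  have hn8 : n ≤ 8 := by rw [hn] at h; exact_mod_cast h
  have hterm : ∀ m : ℕ, ({c : PointConfig Phase | c.count W = m}).indicator (fun _ => (m : ℝ≥0∞)) ω =
      if n = m then (m : ℝ≥0∞) else 0 := fun m => by
    by_cases hnm : n = m
    · rw [if_pos hnm, indicator_of_mem]; simp [hn, hnm]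
    · rw [if_neg hnm, indicator_of_notMem]
      simp only [mem_setOf_eq, hn, Nat.cast_inj]; exact hnm
  simp_rw [hterm]
  rw [Finset.sum_ite_eq, if_pos (Finset.mem_range.2 (by omega)), hn, ENat.toENNReal_coe]

/-- The layers `{N(W) = m}` are measurable. [folklore] -/
theorem measurableSet_count_eq {W : Set Phase} (hW : MeasurableSet W) (m : ℕ∞) :
    MeasurableSet {c : PointConfig Phase | c.count W = m} :=
  PointConfig.measurable_count hW (measurableSet_singleton m)

/-- **Mean number of centres in the unit cube as a finite sum of layer probabilities** for a law
carried by hard-sphere configurations: `𝔼 N(C) = ∑_{m<9} m · μ(N(C) = m)`. [folklore] -/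
theorem lintegral_count_unitCube_eq_sum {μ : Measure (PointConfig Phase)}
    (hμ : ∀ᵐ ω ∂μ, HardSphere.IsHardCore 1 ω) :
    ∫⁻ ω, ((ω.count (Prod.fst ⁻¹' (Torus.unitCube (Fin 3) : Set Pos)) : ℕ∞) : ℝ≥0∞) ∂μ =
      ∑ m ∈ Finset.range 9, (m : ℝ≥0∞) *
        μ {c : PointConfig Phase | c.count (Prod.fst ⁻¹' (Torus.unitCube (Fin 3) : Set Pos)) = m} := by
  have hW := measurableSet_fst_preimage_unitCube
  calc ∫⁻ ω, ((ω.count (Prod.fst ⁻¹' (Torus.unitCube (Fin 3) : Set Pos)) : ℕ∞) : ℝ≥0∞) ∂μ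
      = ∫⁻ ω, ∑ m ∈ Finset.range 9, ({c : PointConfig Phase |
          c.count (Prod.fst ⁻¹' (Torus.unitCube (Fin 3) : Set Pos)) = m}).indicator (fun _ => (m : ℝ≥0∞)) ω ∂μ :=
        lintegral_congr_ae (hμ.mono fun ω hω => coe_count_eq_sum_indicator (count_unitCube_le_of_isHardCore hω))
    _ = ∑ m ∈ Finset.range 9, ∫⁻ ω, ({c : PointConfig Phase |
          c.count (Prod.fst ⁻¹' (Torus.unitCube (Fin 3) : Set Pos)) = m}).indicator (fun _ => (m : ℝ≥0∞)) ω ∂μ :=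
        lintegral_finsetSum _ fun m _ => (measurable_const.indicator (measurableSet_count_eq hW _))
    _ = _ := Finset.sum_congr rfl fun m _ => lintegral_indicator_const (measurableSet_count_eq hW _) _

/-- The density of a law carried by hard-sphere configurations, as a finite sum. [folklore] -/
theorem density_eq_sum {μ : Measure (PointConfig Phase)} (hμ : ∀ᵐ ω ∂μ, HardSphere.IsHardCore 1 ω) :
    PointProcess.density μ = ∑ m ∈ Finset.range 9, (m : ℝ≥0∞) *
      μ {c : PointConfig Phase | c.count (Prod.fst ⁻¹' (Torus.unitCube (Fin 3) : Set Pos)) = m} :=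
  lintegral_count_unitCube_eq_sum hμ

/-- The layers are local events over `B(0, 2)`. [folklore] -/
theorem restrict_preimage_count_unitCube_eq (m : ℕ∞) :
    PointConfig.restrict (window (Metric.ball (0 : Pos) 2)) ⁻¹'
        {c : PointConfig Phase | c.count (Prod.fst ⁻¹' (Torus.unitCube (Fin 3) : Set Pos)) = m} =
      {c : PointConfig Phase | c.count (Prod.fst ⁻¹' (Torus.unitCube (Fin 3) : Set Pos)) = m} := by
  ext c
  simp only [mem_preimage, mem_setOf_eq, PointConfig.count_restrict]
  have : window (Metric.ball (0 : Pos) 2) ∩ Prod.fst ⁻¹' (Torus.unitCube (Fin 3) : Set Pos) =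
      Prod.fst ⁻¹' (Torus.unitCube (Fin 3) : Set Pos) := by
    refine inter_eq_right.2 fun p hp => ?_
    exact HardSphere.mem_window.2 (torusUnitCube_subset_ball hp)
  rw [this]

/-! ### The free finite-volume probabilities as ratios of power series in `z`; continuity -/

/-- Cancelling a nonzero finite factor: `(E X)⁻¹ (E Y) = X⁻¹ Y` in `ℝ≥0∞`. [folklore] -/
theorem inv_mul_mul_cancel_left {E X Y : ℝ≥0∞} (h0 : E ≠ 0) (htop : E ≠ ∞) :
    (E * X)⁻¹ * (E * Y) = X⁻¹ * Y := by
  rw [ENNReal.mul_inv (Or.inl h0) (Or.inl htop)]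
  calc E⁻¹ * X⁻¹ * (E * Y) = (E⁻¹ * E) * (X⁻¹ * Y) := by ring
    _ = X⁻¹ * Y := by rw [ENNReal.inv_mul_cancel h0 htop, one_mul]

/-- **Janossy form of the glued window law, general marks**: for `ν = z · Leb ⊗ M` with a
probability mark law `M`, a bounded measurable window `Λ`, a boundary condition `η` and a measurable
event `S`, `P_{ν|Λ}(glue_η⁻¹ S) = e^{-z|Λ|} ∑ₖ (k!)⁻¹ zᵏ ∫ 𝟙_S(glue_η {x}) d(Leb|_Λ ⊗ M)^{⊗k}`.
[cite: LastPenrose2017, Prop. 3.5] -/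
theorem poissonLaw_glue_preimage_eq_tsum' {z : ℝ} (hz : 0 ≤ z) (M : Measure Pos) [IsProbabilityMeasure M]
    {Λ : Set Pos} (hΛ : MeasurableSet Λ) (hb : Bornology.IsBounded Λ) (η : PointConfig Phase)
    {S : Set (PointConfig Phase)} (hS : MeasurableSet S) :
    poissonLaw ((Real.toNNReal z) • (((volume : Measure Pos).restrict Λ).prod M)) (glue Λ η ⁻¹' S) =
      ENNReal.ofReal (Real.exp (-(z * (volume Λ).toReal))) *
        ∑' k : ℕ, ((k.factorial : ℝ≥0∞))⁻¹ * (ENNReal.ofReal z ^ k *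
          ∫⁻ x, S.indicator 1 (glue Λ η (PointConfig.ofFn x))
            ∂(Measure.pi fun _ : Fin k => ((volume : Measure Pos).restrict Λ).prod M)) := by
  haveI : IsFiniteMeasure (((volume : Measure Pos).restrict Λ).prod M) := isFiniteMeasure_restrict_prod hb _
  set π : Measure Phase := ((volume : Measure Pos).restrict Λ).prod M with hπ
  set m : Measure Phase := (Real.toNNReal z) • π with hm
  haveI : IsFiniteMeasure m := by rw [hm]; infer_instance
  have h0 : ∀ x, m {x} = 0 := fun x => by
    rw [hm, Measure.smul_apply, hπ, ← singleton_prod_singleton, Measure.prod_prod]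
    simp
  have hP : IsPoissonPointProcess m (poissonLaw m) := HardSphere.isPoissonPointProcess_poissonLaw m h0
  have hg : Measurable (glue Λ η) := HardSphere.measurable_glue hΛ η
  rw [hP.measure_eq_tsum_lintegral_ofFn h0 (hS.preimage hg)]
  have huniv : m univ = ENNReal.ofReal (z * (volume Λ).toReal) := by
    rw [hm, Measure.smul_apply, hπ, ← univ_prod_univ, Measure.prod_prod, Measure.restrict_apply_univ,
      measure_univ, mul_one, ENNReal.smul_def, smul_eq_mul, ENNReal.ofReal_mul hz,
      ENNReal.ofReal_toReal hb.measure_lt_top.ne]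
    rfl
  rw [huniv, ENNReal.toReal_ofReal (mul_nonneg hz ENNReal.toReal_nonneg)]
  congr 1
  refine tsum_congr fun k => ?_
  congr 1
  rw [hm, Measure.pi_const_smul, lintegral_smul_measure, Fintype.card_fin]
  rfl

/-- The series `∑ₖ zᵏ/k! J_k(S)` of the free finite-volume distribution, with
`J_k(S) = ∫ 𝟙_S({x}|_Λ) d(Leb|_Λ ⊗ M)^{⊗k}` (a function of `z`; abbreviation-free statement).
**The free finite-volume hard-sphere probabilities are ratios of such series**:
`γ_Λ(∅)(A) = (∑ₖ zᵏ/k! J_k(HC))⁻¹ ∑ₖ zᵏ/k! J_k(A ∩ HC)`. [cite: Ruelle1969, §1.2.1 (2.10)–(2.12)] -/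
theorem hsLocalSpec_empty_apply_eq {z : ℝ} (hz : 0 ≤ z) (M : Measure Pos) [IsProbabilityMeasure M] (σ : ℝ)
    {Λ : Set Pos} (hΛ : MeasurableSet Λ) (hb : Bornology.IsBounded Λ) {A : Set (PointConfig Phase)}
    (hA : MeasurableSet A) :
    hsLocalSpec σ ((Real.toNNReal z) • ((volume : Measure Pos).prod M)) Λ ∅ A =
      (∑' k : ℕ, ((k.factorial : ℝ≥0∞))⁻¹ * (ENNReal.ofReal z ^ k *
          ∫⁻ x, (hardCoreSet σ).indicator 1 ((PointConfig.ofFn x).restrict (window Λ))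
            ∂(Measure.pi fun _ : Fin k => ((volume : Measure Pos).restrict Λ).prod M)))⁻¹ *
      (∑' k : ℕ, ((k.factorial : ℝ≥0∞))⁻¹ * (ENNReal.ofReal z ^ k *
          ∫⁻ x, (A ∩ hardCoreSet σ).indicator 1 ((PointConfig.ofFn x).restrict (window Λ))
            ∂(Measure.pi fun _ : Fin k => ((volume : Measure Pos).restrict Λ).prod M))) := by
  have hH := HardSphere.measurableSet_hardCoreSet σ
  set E : ℝ≥0∞ := ENNReal.ofReal (Real.exp (-(z * (volume Λ).toReal))) with hE
  have hE0 : E ≠ 0 := (ENNReal.ofReal_pos.2 (Real.exp_pos _)).ne'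
  have hEtop : E ≠ ∞ := ENNReal.ofReal_ne_top
  rw [hsLocalSpec_apply_eq _ σ hΛ ∅ hA, restrict_window_smul_prod, poissonLaw_glue_preimage_eq_tsum' hz M hΛ hb ∅ hH,
    poissonLaw_glue_preimage_eq_tsum' hz M hΛ hb ∅ (hA.inter hH)]
  simp_rw [glue_empty]
  exact inv_mul_mul_cancel_left hE0 hEtop

/-- The coefficients `J_k(S) ≤ |Λ|ᵏ` are finite. [folklore] -/
theorem lintegral_indicator_ofFn_le {M : Measure Pos} [IsProbabilityMeasure M] {Λ : Set Pos}
    (hb : Bornology.IsBounded Λ) (S : Set (PointConfig Phase)) (k : ℕ) :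
    ∫⁻ x, S.indicator (1 : PointConfig Phase → ℝ≥0∞) ((PointConfig.ofFn x).restrict (window Λ))
        ∂(Measure.pi fun _ : Fin k => ((volume : Measure Pos).restrict Λ).prod M) ≤ volume Λ ^ k := by
  haveI := isFiniteMeasure_restrict_prod hb M
  calc ∫⁻ x, S.indicator (1 : PointConfig Phase → ℝ≥0∞) ((PointConfig.ofFn x).restrict (window Λ))
        ∂(Measure.pi fun _ : Fin k => ((volume : Measure Pos).restrict Λ).prod M)
      ≤ ∫⁻ _x, 1 ∂(Measure.pi fun _ : Fin k => ((volume : Measure Pos).restrict Λ).prod M) :=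
        lintegral_mono fun x => indicator_apply_le' (fun _ => le_rfl) (fun _ => zero_le_one)
    _ = volume Λ ^ k := by
        rw [lintegral_one, Measure.pi_univ, Finset.prod_const, Finset.card_univ, Fintype.card_fin,
          ← univ_prod_univ, Measure.prod_prod, Measure.restrict_apply_univ, measure_univ, mul_one]

/-- **Continuity of ratios of exponential-type power series**: if `0 ≤ a_k ≤ Vᵏ`, `0 ≤ b_k ≤ Vᵏ`
and `b₀ = 1`, then `z ↦ (∑ₖ zᵏ/k! a_k)/(∑ₖ zᵏ/k! b_k)` is continuous on `[0, Z]`. [folklore] -/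
theorem continuousOn_div_tsum {a b : ℕ → ℝ} {V Z : ℝ} (hZ : 0 ≤ Z)
    (ha0 : ∀ k, 0 ≤ a k) (ha : ∀ k, a k ≤ V ^ k) (hb0 : ∀ k, 0 ≤ b k) (hb : ∀ k, b k ≤ V ^ k) (hb1 : b 0 = 1) :
    ContinuousOn (fun z : ℝ => (∑' k, z ^ k / k.factorial * a k) / (∑' k, z ^ k / k.factorial * b k)) (Icc 0 Z) := by
  have hu : Summable fun k : ℕ => (Z * V) ^ k / k.factorial := Real.summable_pow_div_factorial (Z * V)
  have hbound : ∀ (c : ℕ → ℝ), (∀ k, 0 ≤ c k) → (∀ k, c k ≤ V ^ k) →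
      ∀ (k : ℕ) (z : ℝ), z ∈ Icc 0 Z → ‖z ^ k / k.factorial * c k‖ ≤ (Z * V) ^ k / k.factorial := by
    intro c hc0 hc k z hz
    have h1 : 0 ≤ c k := hc0 k
    have h2 : z ^ k / k.factorial * c k ≤ Z ^ k / k.factorial * V ^ k :=
      mul_le_mul (div_le_div_of_nonneg_right (pow_le_pow_left₀ hz.1 hz.2 k) (Nat.cast_nonneg _)) (hc k) h1
        (div_nonneg (pow_nonneg hZ _) (Nat.cast_nonneg _))
    rw [Real.norm_eq_abs, abs_of_nonneg (mul_nonneg (div_nonneg (pow_nonneg hz.1 _) (Nat.cast_nonneg _)) h1)]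
    calc z ^ k / k.factorial * c k ≤ Z ^ k / k.factorial * V ^ k := h2
      _ = (Z * V) ^ k / k.factorial := by rw [mul_pow]; ring
  have hcont : ∀ (c : ℕ → ℝ) (k : ℕ), ContinuousOn (fun z : ℝ => z ^ k / k.factorial * c k) (Icc 0 Z) :=
    fun c k => ((continuous_pow k).div_const _).mul continuous_const |>.continuousOn
  have hN : ContinuousOn (fun z : ℝ => ∑' k, z ^ k / k.factorial * a k) (Icc 0 Z) :=
    continuousOn_tsum (hcont a) hu (hbound a ha0 ha)
  have hD : ContinuousOn (fun z : ℝ => ∑' k, z ^ k / k.factorial * b k) (Icc 0 Z) :=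
    continuousOn_tsum (hcont b) hu (hbound b hb0 hb)
  refine hN.div hD fun z hz => ?_
  have hsum : Summable fun k : ℕ => z ^ k / k.factorial * b k :=
    Summable.of_norm_bounded hu (fun k => hbound b hb0 hb k z hz)
  have h1 : (1 : ℝ) ≤ ∑' k, z ^ k / k.factorial * b k := by
    have h := hsum.le_tsum 0 (fun j _ => mul_nonneg (div_nonneg (pow_nonneg hz.1 _) (Nat.cast_nonneg _)) (hb0 j))
    simpa [hb1] using h
  linarith

/-- **The free finite-volume hard-sphere probabilities depend continuously on the activity**:
for `ν_z = z · Leb ⊗ M` (probability mark law `M`), a bounded measurable window `Λ` and a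
measurable event `A`, `z ↦ γ^{ν_z}_Λ(∅)(A)` is continuous on every `[0, Z]`.
[cite: Ruelle1969, §4.2 Thm 4.2.3] -/
theorem continuousOn_hsLocalSpec_empty_toReal (M : Measure Pos) [IsProbabilityMeasure M] (σ : ℝ)
    {Λ : Set Pos} (hΛ : MeasurableSet Λ) (hb : Bornology.IsBounded Λ) {A : Set (PointConfig Phase)}
    (hA : MeasurableSet A) {Z : ℝ} (hZ : 0 ≤ Z) :
    ContinuousOn (fun z : ℝ => (hsLocalSpec σ ((Real.toNNReal z) • ((volume : Measure Pos).prod M)) Λ ∅ A).toReal)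
      (Icc 0 Z) := by
  -- the coefficients
  set J : Set (PointConfig Phase) → ℕ → ℝ≥0∞ := fun S k =>
    ∫⁻ x, S.indicator (1 : PointConfig Phase → ℝ≥0∞) ((PointConfig.ofFn x).restrict (window Λ))
      ∂(Measure.pi fun _ : Fin k => ((volume : Measure Pos).restrict Λ).prod M) with hJ
  set V : ℝ := (volume Λ).toReal with hV
  have hVtop : volume Λ ≠ ∞ := hb.measure_lt_top.ne
  have hJle : ∀ S k, J S k ≤ volume Λ ^ k := fun S k => lintegral_indicator_ofFn_le hb S k
  have hJtop : ∀ S k, J S k ≠ ∞ := fun S k =>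
    ne_top_of_le_ne_top (ENNReal.pow_ne_top hVtop) (hJle S k)
  have hJreal : ∀ S k, (J S k).toReal ≤ V ^ k := fun S k => by
    rw [hV, ← ENNReal.toReal_pow]
    exact ENNReal.toReal_mono (ENNReal.pow_ne_top hVtop) (hJle S k)
  -- the series as `ofReal` of real series
  have hseries : ∀ (S : Set (PointConfig Phase)) {z : ℝ}, 0 ≤ z →
      ∑' k : ℕ, ((k.factorial : ℝ≥0∞))⁻¹ * (ENNReal.ofReal z ^ k * J S k) =
        ENNReal.ofReal (∑' k : ℕ, z ^ k / k.factorial * (J S k).toReal) := by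
    intro S z hz
    have hnn : ∀ k : ℕ, 0 ≤ z ^ k / k.factorial * (J S k).toReal := fun k =>
      mul_nonneg (div_nonneg (pow_nonneg hz _) (Nat.cast_nonneg _)) ENNReal.toReal_nonneg
    have hsum : Summable fun k : ℕ => z ^ k / k.factorial * (J S k).toReal := by
      refine Summable.of_nonneg_of_le hnn (fun k => ?_) (Real.summable_pow_div_factorial (z * V))
      rw [mul_pow, mul_div_right_comm]
      exact mul_le_mul_of_nonneg_left (hJreal S k) (div_nonneg (pow_nonneg hz _) (Nat.cast_nonneg _))
    rw [ENNReal.ofReal_tsum_of_nonneg hnn hsum]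
    refine tsum_congr fun k => ?_
    rw [ENNReal.ofReal_mul (div_nonneg (pow_nonneg hz _) (Nat.cast_nonneg _)),
      ENNReal.ofReal_div_of_pos (by exact_mod_cast k.factorial_pos), ENNReal.ofReal_pow hz, ENNReal.ofReal_natCast,
      ENNReal.ofReal_toReal (hJtop S k), div_eq_mul_inv]
    ring
  have hH := HardSphere.measurableSet_hardCoreSet σ
  -- the continuous real ratio
  have hcont := continuousOn_div_tsum (a := fun k => (J (A ∩ hardCoreSet σ) k).toReal)
    (b := fun k => (J (hardCoreSet σ) k).toReal) (V := V) hZ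
    (fun k => ENNReal.toReal_nonneg) (hJreal _) (fun k => ENNReal.toReal_nonneg) (hJreal _) ?_
  · refine hcont.congr fun z hz => ?_
    have hnnA : 0 ≤ ∑' k : ℕ, z ^ k / k.factorial * (J (A ∩ hardCoreSet σ) k).toReal :=
      tsum_nonneg fun k => mul_nonneg (div_nonneg (pow_nonneg hz.1 _) (Nat.cast_nonneg _)) ENNReal.toReal_nonneg
    have hnnH : 0 ≤ ∑' k : ℕ, z ^ k / k.factorial * (J (hardCoreSet σ) k).toReal :=
      tsum_nonneg fun k => mul_nonneg (div_nonneg (pow_nonneg hz.1 _) (Nat.cast_nonneg _)) ENNReal.toReal_nonneg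
    simp only
    rw [hsLocalSpec_empty_apply_eq hz.1 M σ hΛ hb hA]
    change ((∑' k : ℕ, ((k.factorial : ℝ≥0∞))⁻¹ * (ENNReal.ofReal z ^ k * J (hardCoreSet σ) k))⁻¹ *
      ∑' k : ℕ, ((k.factorial : ℝ≥0∞))⁻¹ * (ENNReal.ofReal z ^ k * J (A ∩ hardCoreSet σ) k)).toReal = _
    rw [hseries _ hz.1, hseries _ hz.1, ENNReal.toReal_mul, ENNReal.toReal_inv, ENNReal.toReal_ofReal hnnA,
      ENNReal.toReal_ofReal hnnH, inv_mul_eq_div]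
  · -- `J_0(HC) = 1`: the empty configuration is hard core
    simp only [hJ]
    rw [Measure.pi_of_empty, lintegral_dirac]
    have : (PointConfig.ofFn (fun a : Fin 0 => isEmptyElim a) : PointConfig Phase).restrict (window Λ) ∈ hardCoreSet σ :=
      (HardSphere.isHardCore_empty σ).of_subset (by
        rintro y ⟨⟨i, -⟩, -⟩; exact i.elim0)
    rw [indicator_of_mem this]
    simp

/-! ### Pinning of the layer probabilities, uniformly in the activity; continuity of the density -/

/-- The volume of a ball of radius `2` in `ℝ³` is at most `64`. [folklore] -/
theorem volume_ball_two_le (a : Pos) : volume (Metric.ball a (2 : ℝ)) ≤ ENNReal.ofReal 64 :=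
  (volume_ball_le a 2).trans_eq (by rw [← ENNReal.ofReal_pow (by norm_num)]; norm_num)

/-- The volume of a ball of radius `1` in `ℝ³` is at most `8`. [folklore] -/
theorem volume_ball_one_le (a : Pos) : volume (Metric.ball a (1 : ℝ)) ≤ ENNReal.ofReal 8 :=
  (volume_ball_le a 1).trans_eq (by rw [← ENNReal.ofReal_pow (by norm_num)]; norm_num)

/-- **Pinning of the layer probabilities, uniformly in `z ≤ 1/32`**: for any DLR state `μ` of
`(1, z · Leb ⊗ M)` (`M` a probability mark law) and every layer `A_m = {N(C × ℝ³) = m}`,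
`|μ(A_m) - γ^{z}_{B(0, 2+(d+2))}(∅)(A_m)| ≤ 4 e² 2^{-d}` (the tree's pinning estimate with `k = 2`,
`κ = 8z ≤ 1/4`, `ν(B(0,2) × ℝ³) ≤ 64 z ≤ 2`). [cite: MichelenPerkins2021, §5, proof of Thm 25] -/
theorem abs_measureReal_layer_sub_le {z : ℝ} (hz : 0 ≤ z) (hz1 : z ≤ 1 / 32) (M : Measure Pos)
    [IsProbabilityMeasure M] {μ : Measure (PointConfig Phase)}
    (hμ : IsHsLocalGibbs 1 ((Real.toNNReal z) • ((volume : Measure Pos).prod M)) μ) (m : ℕ∞) (d : ℕ) :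
    |μ.real {c : PointConfig Phase | c.count (Prod.fst ⁻¹' (Torus.unitCube (Fin 3) : Set Pos)) = m} -
      (hsLocalSpec 1 ((Real.toNNReal z) • ((volume : Measure Pos).prod M))
        (Metric.ball 0 (((2 : ℕ) : ℝ) + ((d : ℝ) + 2) * 1)) ∅
        {c : PointConfig Phase | c.count (Prod.fst ⁻¹' (Torus.unitCube (Fin 3) : Set Pos)) = m}).toReal| ≤
      4 * Real.exp 2 * (1 / 2) ^ d := by
  set ν : Measure Phase := (Real.toNNReal z) • ((volume : Measure Pos).prod M) with hν
  haveI : IsLocallyFiniteMeasure ν := by rw [hν]; infer_instance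
  have h0 : ∀ x, ν {x} = 0 := smul_prod_singleton z M
  have hm : ∀ t : ℝ, ν {y : Phase | y.1 0 = t} = 0 := smul_prod_setOf_fst_apply_zero z M
  have hκ0 : (0 : ℝ) ≤ 8 * z := by positivity
  have hκ : ∀ a : Pos, ν (window (Metric.ball a 1)) ≤ ENNReal.ofReal (8 * z) := fun a => by
    rw [hν, smul_prod_window, measure_univ, mul_one, mul_comm (8 : ℝ) z, ENNReal.ofReal_mul hz]
    gcongr
    exact volume_ball_one_le a
  have hfin : ∀ R : ℝ, ν (window (Metric.ball (0 : Pos) R)) ≠ ∞ := fun R => by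
    rw [hν, smul_prod_window, measure_univ, mul_one]
    exact ENNReal.mul_ne_top ENNReal.ofReal_ne_top Metric.isBounded_ball.measure_lt_top.ne
  have hW := measurableSet_fst_preimage_unitCube
  have h := hμ.abs_measureReal_sub_hsLocalSpec_empty_le ν one_pos h0 hm hκ0 hκ hfin 2 d (measurableSet_count_eq hW m)
  rw [Nat.cast_ofNat, restrict_preimage_count_unitCube_eq] at h
  refine h.trans ?_
  -- the constants: `ν(B(0,2) × ℝ³) ≤ 64 z ≤ 2`, `2κ = 16 z ≤ 1/2`
  have hνW : ν.real (window (Metric.ball (0 : Pos) 2)) ≤ 2 := by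
    rw [measureReal_def, hν, smul_prod_window, measure_univ, mul_one]
    have h64 : ENNReal.ofReal z * volume (Metric.ball (0 : Pos) 2) ≤ ENNReal.ofReal (z * 64) := by
      rw [ENNReal.ofReal_mul hz]; gcongr; exact volume_ball_two_le 0
    calc (ENNReal.ofReal z * volume (Metric.ball (0 : Pos) 2)).toReal ≤ (ENNReal.ofReal (z * 64)).toReal :=
          ENNReal.toReal_mono ENNReal.ofReal_ne_top h64
      _ = z * 64 := ENNReal.toReal_ofReal (by positivity)
      _ ≤ 2 := by linarith
  have hνW0 : 0 ≤ ν.real (window (Metric.ball (0 : Pos) 2)) := measureReal_nonneg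
  have hexp : Real.exp (ν.real (window (Metric.ball (0 : Pos) 2))) ≤ Real.exp 2 := Real.exp_le_exp.2 hνW
  have hpow : (2 * (8 * z)) ^ d ≤ (1 / 2 : ℝ) ^ d := pow_le_pow_left₀ (by positivity) (by linarith) d
  calc 2 * ν.real (window (Metric.ball (0 : Pos) 2)) * Real.exp (ν.real (window (Metric.ball (0 : Pos) 2))) * (2 * (8 * z)) ^ d
      ≤ 2 * 2 * Real.exp 2 * (1 / 2 : ℝ) ^ d := by
        gcongr
    _ = 4 * Real.exp 2 * (1 / 2) ^ d := by ring

/-- **The layer probabilities of the low-activity states depend continuously on the activity.**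
For `0 ≤ z ≤ 1/32` let `G_z` be any family of DLR states of `(1, z · Leb ⊗ M)`; then
`z ↦ G_z(A_m)` is continuous on `[0, 1/32]`: it is the uniform limit (pinning) of the free
finite-volume probabilities, which are continuous in `z`. [cite: Ruelle1969, §4.3 Thm 4.3.1] -/
theorem continuousOn_measureReal_layer (M : Measure Pos) [IsProbabilityMeasure M]
    (G : ℝ → Measure (PointConfig Phase))
    (hG : ∀ z ∈ Icc (0 : ℝ) (1 / 32), IsHsLocalGibbs 1 ((Real.toNNReal z) • ((volume : Measure Pos).prod M)) (G z))
    (m : ℕ∞) :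
    ContinuousOn (fun z => (G z).real
      {c : PointConfig Phase | c.count (Prod.fst ⁻¹' (Torus.unitCube (Fin 3) : Set Pos)) = m}) (Icc 0 (1 / 32)) := by
  set A : Set (PointConfig Phase) := {c | c.count (Prod.fst ⁻¹' (Torus.unitCube (Fin 3) : Set Pos)) = m} with hA
  have hAm : MeasurableSet A := measurableSet_count_eq measurableSet_fst_preimage_unitCube m
  set F : ℕ → ℝ → ℝ := fun d z => (hsLocalSpec 1 ((Real.toNNReal z) • ((volume : Measure Pos).prod M))
    (Metric.ball 0 (((2 : ℕ) : ℝ) + ((d : ℝ) + 2) * 1)) ∅ A).toReal with hF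
  have hcont : ∀ d, ContinuousOn (F d) (Icc 0 (1 / 32)) := fun d =>
    continuousOn_hsLocalSpec_empty_toReal M 1 Metric.isOpen_ball.measurableSet Metric.isBounded_ball hAm
      (by norm_num)
  have hunif : TendstoUniformlyOn F (fun z => (G z).real A) atTop (Icc 0 (1 / 32)) := by
    rw [Metric.tendstoUniformlyOn_iff]
    intro ε hε
    have htend : Tendsto (fun d : ℕ => 4 * Real.exp 2 * (1 / 2 : ℝ) ^ d) atTop (𝓝 0) := by
      have h := (tendsto_pow_atTop_nhds_zero_of_lt_one (by norm_num : (0 : ℝ) ≤ 1 / 2)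
        (by norm_num : (1 / 2 : ℝ) < 1)).const_mul (4 * Real.exp 2)
      rwa [mul_zero] at h
    filter_upwards [htend.eventually (eventually_lt_nhds hε)] with d hd z hz
    rw [Real.dist_eq]
    exact (abs_measureReal_layer_sub_le hz.1 hz.2 M (hG z hz) m d).trans_lt hd
  exact hunif.continuousOn (Frequently.of_forall hcont)

/-- **The density of the low-activity states is a continuous function of the activity** on
`[0, 1/32]` (finite sum of layer probabilities, each continuous). [cite: Ruelle1969, §4.3 Thm 4.3.1] -/
theorem continuousOn_density_toReal (M : Measure Pos) [IsProbabilityMeasure M]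
    (G : ℝ → Measure (PointConfig Phase))
    (hG : ∀ z ∈ Icc (0 : ℝ) (1 / 32), IsHsLocalGibbs 1 ((Real.toNNReal z) • ((volume : Measure Pos).prod M)) (G z)) :
    ContinuousOn (fun z => (PointProcess.density (G z)).toReal) (Icc 0 (1 / 32)) := by
  have heq : ∀ z ∈ Icc (0 : ℝ) (1 / 32), (PointProcess.density (G z)).toReal =
      ∑ m ∈ Finset.range 9, (m : ℝ) * (G z).real
        {c : PointConfig Phase | c.count (Prod.fst ⁻¹' (Torus.unitCube (Fin 3) : Set Pos)) = m} := by
    intro z hz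
    haveI := (hG z hz).isProbabilityMeasure
    rw [density_eq_sum (hG z hz).ae_isHardCore, ENNReal.toReal_sum (fun m _ =>
      ENNReal.mul_ne_top (ENNReal.natCast_ne_top _) (measure_ne_top _ _))]
    refine Finset.sum_congr rfl fun m _ => ?_
    rw [ENNReal.toReal_mul, ENNReal.toReal_natCast, measureReal_def]
  refine (continuousOn_finsetSum _ fun m _ => ?_).congr heq
  exact continuousOn_const.mul (continuousOn_measureReal_layer M G hG (m : ℕ∞))

/-! ### First-moment bounds in finite volume (Mecke equation): `z - 8z² ≤ 𝔼_γ N(C) ≤ z` -/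

section Mecke

/-- Summing an indicator over the points of a configuration counts them. [folklore] -/
theorem tsum_coe_indicator_one (c : PointConfig Phase) (s : Set Phase) :
    ∑' a : (c : Set Phase), s.indicator (1 : Phase → ℝ≥0∞) a = ((c.count s : ℕ∞) : ℝ≥0∞) := by
  have h1 : ∑' a : (c : Set Phase), s.indicator (1 : Phase → ℝ≥0∞) a =
      ∑' a : Phase, (c : Set Phase).indicator (s.indicator 1) a :=
    tsum_subtype (c : Set Phase) (s.indicator (1 : Phase → ℝ≥0∞))
  have h2 : ∑' a : ((c : Set Phase) ∩ s : Set Phase), (1 : Phase → ℝ≥0∞) a =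
      ∑' a : Phase, ((c : Set Phase) ∩ s).indicator 1 a :=
    tsum_subtype ((c : Set Phase) ∩ s) (1 : Phase → ℝ≥0∞)
  rw [h1, Set.indicator_indicator, ← h2]
  simp only [Pi.one_apply, ENNReal.tsum_set_one]
  rfl

variable {ν : Measure Phase} {P : Measure (PointConfig Phase)} {Λ : Set Pos}

/-- Hard core of the window configuration is inherited from a super-configuration. [folklore] -/
theorem restrict_mem_hardCoreSet_of_union {σ : ℝ} {c d : PointConfig Phase}
    (h : (c ∪ d).restrict (window Λ) ∈ hardCoreSet σ) : c.restrict (window Λ) ∈ hardCoreSet σ :=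
  HardSphere.IsHardCore.of_subset h fun _ hx => ⟨Or.inl hx.1, hx.2⟩

/-- **Mecke upper bound**: under the Poisson law `P` of intensity `ν|_{Λ×ℝ³}`,
`𝔼_P[𝟙_{HC}(ξ|_Λ) N_{ξ|_Λ}(T)] ≤ ν(T) · P(HC(ξ|_Λ))` (insert the point by Mecke's equation and
drop it from the hard-core constraint, which is hereditary). [cite: LastPenrose2017, Thm 4.1] -/
theorem lintegral_indicator_mul_count_le [IsFiniteMeasure (ν.restrict (window Λ))]
    (hP : IsPoissonPointProcess (ν.restrict (window Λ)) P) (hΛ : MeasurableSet Λ) {σ : ℝ}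
    {T : Set Phase} (hT : MeasurableSet T) :
    ∫⁻ c, (PointConfig.restrict (window Λ) ⁻¹' hardCoreSet σ).indicator 1 c *
        (((c.restrict (window Λ)).count T : ℕ∞) : ℝ≥0∞) ∂P ≤
      ν T * P (PointConfig.restrict (window Λ) ⁻¹' hardCoreSet σ) := by
  haveI := hP.isProbabilityMeasure
  have hW : MeasurableSet (window Λ) := HardSphere.measurableSet_window hΛ
  set HCr : Set (PointConfig Phase) := PointConfig.restrict (window Λ) ⁻¹' hardCoreSet σ with hHCr
  have hHCm : MeasurableSet HCr := (HardSphere.measurableSet_hardCoreSet σ).preimage (PointConfig.measurable_restrict hW)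
  set f : PointConfig Phase × Phase → ℝ≥0∞ := fun p => HCr.indicator 1 p.1 * (window Λ ∩ T).indicator 1 p.2 with hf
  have hfm : Measurable f :=
    ((measurable_one.indicator hHCm).comp measurable_fst).mul ((measurable_one.indicator (hW.inter hT)).comp measurable_snd)
  have hL : ∀ c : PointConfig Phase, HCr.indicator (1 : PointConfig Phase → ℝ≥0∞) c *
      (((c.restrict (window Λ)).count T : ℕ∞) : ℝ≥0∞) = ∑' a : (c : Set Phase), f (c, a) := fun c => by
    simp only [hf]
    rw [ENNReal.tsum_mul_left, tsum_coe_indicator_one, PointConfig.count_restrict]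
  simp_rw [hL]
  rw [hP.lintegral_tsum_eq_lintegral_lintegral_insert hfm]
  have hind : ∀ c : PointConfig Phase, HCr.indicator (1 : PointConfig Phase → ℝ≥0∞) c ≤ 1 := fun c =>
    indicator_apply_le' (fun _ => le_rfl) (fun _ => zero_le_one)
  calc ∫⁻ a, ∫⁻ c, f (c ∪ PointConfig.ofFn (fun _ : Fin 1 => a), a) ∂P ∂(ν.restrict (window Λ))
      ≤ ∫⁻ a, ∫⁻ c, HCr.indicator 1 c * (window Λ ∩ T).indicator 1 a ∂P ∂(ν.restrict (window Λ)) := by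
        refine lintegral_mono fun a => lintegral_mono fun c => ?_
        simp only [hf]
        gcongr
        by_cases hc : c ∪ PointConfig.ofFn (fun _ : Fin 1 => a) ∈ HCr
        · simp only [indicator_of_mem hc, indicator_of_mem (show c ∈ HCr from restrict_mem_hardCoreSet_of_union hc),
            Pi.one_apply, le_refl]
        · rw [indicator_of_notMem hc]; exact bot_le
    _ = ∫⁻ a, (window Λ ∩ T).indicator 1 a * P HCr ∂(ν.restrict (window Λ)) := by
        refine lintegral_congr fun a => ?_
        rw [lintegral_mul_const _ (measurable_one.indicator hHCm), lintegral_indicator_one hHCm, mul_comm]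
    _ = ν.restrict (window Λ) (window Λ ∩ T) * P HCr := by
        rw [lintegral_mul_const _ (measurable_one.indicator (hW.inter hT)), lintegral_indicator_one (hW.inter hT)]
    _ ≤ ν T * P HCr :=
        mul_le_mul' ((Measure.restrict_apply_le _ _).trans (measure_mono inter_subset_right)) le_rfl

/-- **Insertion inequality**: for `a ∈ Λ × ℝ³` not a point of `c`,
`𝟙_{HC}(c|_Λ) ≤ 𝟙_{HC}((c ∪ {a})|_Λ) + 𝟙_{HC}(c|_Λ) N_{c|_Λ}(B°₁(a) × ℝ³)` (a hard-core window
configuration with no centre within distance `1` of `a` stays hard core after inserting `a`).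
[folklore] -/
theorem indicator_hardCore_le_insert_add {σ : ℝ} {c : PointConfig Phase} {a : Phase}
    (ha : a ∈ window Λ) (hac : a ∉ c) :
    (PointConfig.restrict (window Λ) ⁻¹' hardCoreSet σ).indicator (1 : PointConfig Phase → ℝ≥0∞) c ≤
      (PointConfig.restrict (window Λ) ⁻¹' hardCoreSet σ).indicator 1 (c ∪ PointConfig.ofFn fun _ : Fin 1 => a) +
        (PointConfig.restrict (window Λ) ⁻¹' hardCoreSet σ).indicator 1 c *
          (((c.restrict (window Λ)).count (window (Metric.ball a.1 σ)) : ℕ∞) : ℝ≥0∞) := by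
  set HCr : Set (PointConfig Phase) := PointConfig.restrict (window Λ) ⁻¹' hardCoreSet σ with hHCr
  by_cases hc : c ∈ HCr
  · rw [indicator_of_mem hc, Pi.one_apply, one_mul]
    by_cases hN : (c.restrict (window Λ)).count (window (Metric.ball a.1 σ)) = 0
    · refine le_add_right (le_of_eq ?_)
      rw [indicator_of_mem, Pi.one_apply]
      change HardSphere.IsHardCore σ ((c ∪ PointConfig.ofFn fun _ : Fin 1 => a).restrict (window Λ))
      have hres : (c ∪ PointConfig.ofFn fun _ : Fin 1 => a).restrict (window Λ) =
          c.restrict (window Λ) ∪ PointConfig.ofFn fun _ : Fin 1 => a := by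
        rw [restrict_union']
        congr 1
        refine PointConfig.ext fun x => ?_
        simp only [mem_restrict_iff, PointConfig.mem_ofFn, and_iff_left_iff_imp]
        rintro ⟨_, rfl⟩; exact ha
      rw [hres]
      have hac' : a ∉ c.restrict (window Λ) := fun h => hac h.1
      exact (isHardCore_union_ofFn_one_iff hac').2 ⟨hc, hN⟩
    · refine le_add_left ?_
      have h1 : (1 : ℕ∞) ≤ (c.restrict (window Λ)).count (window (Metric.ball a.1 σ)) :=
        Order.one_le_iff_ne_zero.2 hN
      exact_mod_cast h1
  · rw [indicator_of_notMem hc]; exact bot_le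

/-- **Mecke lower bound**: for measurable `T ⊆ Λ × ℝ³` and `ν(B°₁(q) × ℝ³) ≤ K` for all `q`,
`ν(T) P(HC) ≤ 𝔼_P[𝟙_{HC}(ξ|_Λ) N_{ξ|_Λ}(T)] + ν(T) K P(HC)` (integrate the insertion inequality
against `P ⊗ ν|_T`, Mecke's equation for the first term, the upper bound for the second).
[cite: LastPenrose2017, Thm 4.1] -/
theorem measure_mul_le_lintegral_add [IsFiniteMeasure (ν.restrict (window Λ))]
    (hP : IsPoissonPointProcess (ν.restrict (window Λ)) P) (hΛ : MeasurableSet Λ)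
    {T : Set Phase} (hT : MeasurableSet T) (hTΛ : T ⊆ window Λ) {K : ℝ≥0∞}
    (hK : ∀ q : Pos, ν (window (Metric.ball q 1)) ≤ K) :
    ν.restrict (window Λ) T * P (PointConfig.restrict (window Λ) ⁻¹' hardCoreSet 1) ≤
      ∫⁻ c, (PointConfig.restrict (window Λ) ⁻¹' hardCoreSet 1).indicator 1 c *
          (((c.restrict (window Λ)).count T : ℕ∞) : ℝ≥0∞) ∂P +
        ν.restrict (window Λ) T * (K * P (PointConfig.restrict (window Λ) ⁻¹' hardCoreSet 1)) := by
  haveI := hP.isProbabilityMeasure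
  have hW : MeasurableSet (window Λ) := HardSphere.measurableSet_window hΛ
  set π : Measure Phase := ν.restrict (window Λ) with hπ
  set HCr : Set (PointConfig Phase) := PointConfig.restrict (window Λ) ⁻¹' hardCoreSet 1 with hHCr
  have hHCm : MeasurableSet HCr := (HardSphere.measurableSet_hardCoreSet 1).preimage (PointConfig.measurable_restrict hW)
  have hind1 : Measurable fun c : PointConfig Phase => HCr.indicator (1 : PointConfig Phase → ℝ≥0∞) c :=
    measurable_one.indicator hHCm
  have hins : ∀ a : Phase, Measurable fun c : PointConfig Phase =>
      HCr.indicator (1 : PointConfig Phase → ℝ≥0∞) (c ∪ PointConfig.ofFn fun _ : Fin 1 => a) := fun a =>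
    hind1.comp (PointConfig.measurable_union_ofFn_one.comp (measurable_const.prodMk measurable_id))
  -- Step A: the insertion inequality integrated against `P`, for a fixed `a ∈ Λ × ℝ³`
  have hA : ∀ a ∈ window Λ, P HCr ≤ ∫⁻ c, HCr.indicator 1 (c ∪ PointConfig.ofFn fun _ : Fin 1 => a) ∂P + K * P HCr := by
    intro a ha
    have hae : ∀ᵐ c ∂P, a ∉ c := by
      have h := hP.measure_setOf_mem_eq_zero (measurableSet_singleton a)
      rw [ae_iff]; simpa using h
    calc P HCr = ∫⁻ c, HCr.indicator 1 c ∂P := (lintegral_indicator_one hHCm).symm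
      _ ≤ ∫⁻ c, HCr.indicator 1 (c ∪ PointConfig.ofFn fun _ : Fin 1 => a) +
            HCr.indicator 1 c * (((c.restrict (window Λ)).count (window (Metric.ball a.1 1)) : ℕ∞) : ℝ≥0∞) ∂P :=
          lintegral_mono_ae (hae.mono fun c hc => indicator_hardCore_le_insert_add ha hc)
      _ = ∫⁻ c, HCr.indicator 1 (c ∪ PointConfig.ofFn fun _ : Fin 1 => a) ∂P +
            ∫⁻ c, HCr.indicator 1 c * (((c.restrict (window Λ)).count (window (Metric.ball a.1 1)) : ℕ∞) : ℝ≥0∞) ∂P :=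
          lintegral_add_left (hins a) _
      _ ≤ _ := by
          gcongr
          calc ∫⁻ c, HCr.indicator 1 c * (((c.restrict (window Λ)).count (window (Metric.ball a.1 1)) : ℕ∞) : ℝ≥0∞) ∂P
              ≤ ν (window (Metric.ball a.1 1)) * P HCr :=
                lintegral_indicator_mul_count_le hP hΛ (HardSphere.measurableSet_window Metric.isOpen_ball.measurableSet)
            _ ≤ K * P HCr := by gcongr; exact hK a.1
  -- Step B: integrate over `a ∈ T`
  have hB : π T * P HCr ≤ (∫⁻ a in T, ∫⁻ c, HCr.indicator 1 (c ∪ PointConfig.ofFn fun _ : Fin 1 => a) ∂P ∂π) +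
      K * P HCr * π T := by
    calc π T * P HCr = ∫⁻ _ in T, P HCr ∂π := by rw [setLIntegral_const, mul_comm]
      _ ≤ ∫⁻ a in T, (∫⁻ c, HCr.indicator 1 (c ∪ PointConfig.ofFn fun _ : Fin 1 => a) ∂P + K * P HCr) ∂π :=
          setLIntegral_mono' hT fun a ha => hA a (hTΛ ha)
      _ = _ := by rw [lintegral_add_right _ measurable_const, setLIntegral_const]
  -- the first term is `𝔼[𝟙_{HC} N(T)]` by Mecke's equation
  set f : PointConfig Phase × Phase → ℝ≥0∞ := fun p => HCr.indicator 1 p.1 * T.indicator 1 p.2 with hf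
  have hfm : Measurable f := (hind1.comp measurable_fst).mul ((measurable_one.indicator hT).comp measurable_snd)
  have hmecke := hP.lintegral_tsum_eq_lintegral_lintegral_insert hfm
  have hLHS : ∀ c : PointConfig Phase, (∑' a : (c : Set Phase), f (c, a)) =
      HCr.indicator 1 c * (((c.restrict (window Λ)).count T : ℕ∞) : ℝ≥0∞) := fun c => by
    simp only [hf]
    rw [ENNReal.tsum_mul_left, tsum_coe_indicator_one, PointConfig.count_restrict, inter_eq_right.2 hTΛ]
  have hRHS : ∫⁻ a, ∫⁻ c, f (c ∪ PointConfig.ofFn (fun _ : Fin 1 => a), a) ∂P ∂π =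
      ∫⁻ a in T, ∫⁻ c, HCr.indicator 1 (c ∪ PointConfig.ofFn fun _ : Fin 1 => a) ∂P ∂π := by
    rw [← lintegral_indicator hT]
    refine lintegral_congr fun a => ?_
    simp only [hf]
    rw [lintegral_mul_const _ (hins a)]
    by_cases haT : a ∈ T
    · rw [indicator_of_mem haT, indicator_of_mem haT, Pi.one_apply, mul_one]
    · rw [indicator_of_notMem haT, indicator_of_notMem haT, mul_zero]
  simp_rw [hLHS] at hmecke
  rw [hRHS] at hmecke
  rw [← hmecke] at hB
  calc π T * P HCr ≤ _ := hB
    _ = _ := by ring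

/-- **The mean number of centres under the free finite-volume distribution** in terms of the
reference Poisson law: `𝔼_{γ_Λ(∅)} N(T) = P(HC(ξ|_Λ))⁻¹ 𝔼_P[𝟙_{HC}(ξ|_Λ) N_{ξ|_Λ}(T)]`. [folklore] -/
theorem lintegral_count_hsLocalSpec_empty (σ : ℝ) (ν : Measure Phase) (hΛ : MeasurableSet Λ)
    {T : Set Phase} (hT : MeasurableSet T) :
    ∫⁻ ζ, ((ζ.count T : ℕ∞) : ℝ≥0∞) ∂(hsLocalSpec σ ν Λ ∅) =
      (poissonLaw (ν.restrict (window Λ)) (PointConfig.restrict (window Λ) ⁻¹' hardCoreSet σ))⁻¹ *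
        ∫⁻ c, (PointConfig.restrict (window Λ) ⁻¹' hardCoreSet σ).indicator 1 c *
          (((c.restrict (window Λ)).count T : ℕ∞) : ℝ≥0∞) ∂(poissonLaw (ν.restrict (window Λ))) := by
  have hW : MeasurableSet (window Λ) := HardSphere.measurableSet_window hΛ
  have hH := HardSphere.measurableSet_hardCoreSet σ
  have hr : Measurable (PointConfig.restrict (window Λ) : PointConfig Phase → PointConfig Phase) :=
    PointConfig.measurable_restrict hW
  have hg : glue Λ (∅ : PointConfig Phase) = PointConfig.restrict (window Λ) := funext (glue_empty Λ)
  have hf : Measurable fun ζ : PointConfig Phase => ((ζ.count T : ℕ∞) : ℝ≥0∞) :=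
    measurable_from_top.comp (PointConfig.measurable_count hT)
  rw [hsLocalSpec_def, lintegral_smul_measure, hg, Measure.restrict_apply MeasurableSet.univ, univ_inter,
    Measure.map_apply hr hH, smul_eq_mul]
  congr 1
  rw [← lintegral_indicator hH, lintegral_map (hf.indicator hH) hr]
  refine lintegral_congr fun c => ?_
  by_cases hc : c.restrict (window Λ) ∈ hardCoreSet σ
  · rw [indicator_of_mem hc, indicator_of_mem (show c ∈ PointConfig.restrict (window Λ) ⁻¹' hardCoreSet σ from hc),
      Pi.one_apply, one_mul]
  · rw [indicator_of_notMem hc, indicator_of_notMem (show c ∉ PointConfig.restrict (window Λ) ⁻¹' hardCoreSet σ from hc),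
      zero_mul]

/-- **First-order bounds on the free finite-volume density**: for `ν = z · Leb ⊗ M` (probability
marks), `0 ≤ z`, and a bounded measurable window `Λ ⊇ C = [0,1)³`,
`z - 8 z² ≤ 𝔼_{γ^ν_Λ(∅)} N(C × ℝ³) ≤ z` (Ruelle 1969 (2.5): `ρ_Λ(x) ≤ z` for a non-negative potential;
the lower bound by the union bound on the exclusion ball, `|B°₁| ≤ 8`). [cite: Ruelle1969, §4.2 (2.5) and §4.3 (3.12)] -/
theorem lintegral_count_hsLocalSpec_empty_bounds {z : ℝ} (hz : 0 ≤ z) (M : Measure Pos) [IsProbabilityMeasure M]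
    (hΛ : MeasurableSet Λ) (hb : Bornology.IsBounded Λ) (hC : (Torus.unitCube (Fin 3) : Set Pos) ⊆ Λ) :
    (∫⁻ ζ, ((ζ.count (Prod.fst ⁻¹' (Torus.unitCube (Fin 3) : Set Pos)) : ℕ∞) : ℝ≥0∞)
        ∂(hsLocalSpec 1 ((Real.toNNReal z) • ((volume : Measure Pos).prod M)) Λ ∅)).toReal ≤ z ∧
    z - 8 * z ^ 2 ≤ (∫⁻ ζ, ((ζ.count (Prod.fst ⁻¹' (Torus.unitCube (Fin 3) : Set Pos)) : ℕ∞) : ℝ≥0∞)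
        ∂(hsLocalSpec 1 ((Real.toNNReal z) • ((volume : Measure Pos).prod M)) Λ ∅)).toReal := by
  set ν : Measure Phase := (Real.toNNReal z) • ((volume : Measure Pos).prod M) with hν
  haveI : IsLocallyFiniteMeasure ν := by rw [hν]; infer_instance
  have h0 : ∀ x, ν {x} = 0 := smul_prod_singleton z M
  have hW : MeasurableSet (window Λ) := HardSphere.measurableSet_window hΛ
  have hT : MeasurableSet (Prod.fst ⁻¹' (Torus.unitCube (Fin 3) : Set Pos) : Set Phase) := measurableSet_fst_preimage_unitCube
  have hTΛ : (Prod.fst ⁻¹' (Torus.unitCube (Fin 3) : Set Pos) : Set Phase) ⊆ window Λ := fun p hp =>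
    HardSphere.mem_window.2 (hC hp)
  set π : Measure Phase := ν.restrict (window Λ) with hπ
  haveI : IsFiniteMeasure π := by
    rw [hπ, hν, restrict_window_smul_prod]
    haveI := isFiniteMeasure_restrict_prod hb M
    infer_instance
  set P := poissonLaw π with hPdef
  have hP : IsPoissonPointProcess π P := isPoissonPointProcess_poissonLaw_restrict' ν h0 (window Λ)
  haveI := hP.isProbabilityMeasure
  set HCr : Set (PointConfig Phase) := PointConfig.restrict (window Λ) ⁻¹' hardCoreSet 1 with hHCr
  -- `P(HC) ∈ (0, 1]`
  have hZpos : P HCr ≠ 0 := by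
    have hfinΛ : ν (window Λ) ≠ ∞ := by
      rw [hν, smul_prod_window, measure_univ, mul_one]
      exact ENNReal.mul_ne_top ENNReal.ofReal_ne_top hb.measure_lt_top.ne
    have h := exp_le_measure_glue_preimage_hardCoreSet ν h0 hfinΛ (σ := 1) (η := ∅)
      ((HardSphere.isHardCore_empty 1).restrict _)
    rw [funext (glue_empty Λ)] at h
    exact ne_of_gt (lt_of_lt_of_le (ENNReal.ofReal_pos.2 (Real.exp_pos _)) h)
  have hZtop : P HCr ≠ ∞ := measure_ne_top _ _
  -- the window measures: `ν(C × ℝ³) = z`, `ν(B°₁(q) × ℝ³) ≤ 8z`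
  have hνT : π (Prod.fst ⁻¹' (Torus.unitCube (Fin 3) : Set Pos)) = ENNReal.ofReal z := by
    rw [hπ, Measure.restrict_apply hT, inter_eq_left.2 hTΛ, hν,
      show (Prod.fst ⁻¹' (Torus.unitCube (Fin 3) : Set Pos) : Set Phase) = window (Torus.unitCube (Fin 3)) from by
        ext p; simp,
      smul_prod_window, volume_torusUnitCube, measure_univ, mul_one, mul_one]
  have hνT' : ν (Prod.fst ⁻¹' (Torus.unitCube (Fin 3) : Set Pos)) = ENNReal.ofReal z := by
    rw [← hνT, hπ, Measure.restrict_apply hT, inter_eq_left.2 hTΛ]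
  have hK : ∀ q : Pos, ν (window (Metric.ball q 1)) ≤ ENNReal.ofReal (8 * z) := fun q => by
    rw [hν, smul_prod_window, measure_univ, mul_one, mul_comm (8 : ℝ) z, ENNReal.ofReal_mul hz]
    gcongr
    exact volume_ball_one_le q
  set Q : ℝ≥0∞ := ∫⁻ c, HCr.indicator 1 c *
    (((c.restrict (window Λ)).count (Prod.fst ⁻¹' (Torus.unitCube (Fin 3) : Set Pos)) : ℕ∞) : ℝ≥0∞) ∂P with hQ
  have hup : Q ≤ ENNReal.ofReal z * P HCr := by
    rw [← hνT']; exact lintegral_indicator_mul_count_le hP hΛ hT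
  have hlow : ENNReal.ofReal z * P HCr ≤ Q + ENNReal.ofReal z * (ENNReal.ofReal (8 * z) * P HCr) := by
    rw [← hνT]; exact measure_mul_le_lintegral_add hP hΛ hT hTΛ hK
  have hE : ∫⁻ ζ, ((ζ.count (Prod.fst ⁻¹' (Torus.unitCube (Fin 3) : Set Pos)) : ℕ∞) : ℝ≥0∞)
      ∂(hsLocalSpec 1 ν Λ ∅) = (P HCr)⁻¹ * Q := lintegral_count_hsLocalSpec_empty 1 ν hΛ hT
  rw [hE]
  have e1 : (P HCr)⁻¹ * (ENNReal.ofReal z * P HCr) = ENNReal.ofReal z := by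
    calc (P HCr)⁻¹ * (ENNReal.ofReal z * P HCr) = ENNReal.ofReal z * ((P HCr)⁻¹ * P HCr) := by ring
      _ = ENNReal.ofReal z := by rw [ENNReal.inv_mul_cancel hZpos hZtop, mul_one]
  have e2 : (P HCr)⁻¹ * (Q + ENNReal.ofReal z * (ENNReal.ofReal (8 * z) * P HCr)) =
      (P HCr)⁻¹ * Q + ENNReal.ofReal z * ENNReal.ofReal (8 * z) := by
    calc (P HCr)⁻¹ * (Q + ENNReal.ofReal z * (ENNReal.ofReal (8 * z) * P HCr))
        = (P HCr)⁻¹ * Q + ENNReal.ofReal z * ENNReal.ofReal (8 * z) * ((P HCr)⁻¹ * P HCr) := by ring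
      _ = _ := by rw [ENNReal.inv_mul_cancel hZpos hZtop, mul_one]
  -- upper bound
  have hup' : (P HCr)⁻¹ * Q ≤ ENNReal.ofReal z := by
    calc (P HCr)⁻¹ * Q ≤ (P HCr)⁻¹ * (ENNReal.ofReal z * P HCr) := mul_le_mul' le_rfl hup
      _ = ENNReal.ofReal z := e1
  -- lower bound: divide `hlow` by `P(HC)`
  have hlow' : ENNReal.ofReal z ≤ (P HCr)⁻¹ * Q + ENNReal.ofReal z * ENNReal.ofReal (8 * z) := by
    have h := mul_le_mul' (le_refl (P HCr)⁻¹) hlow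
    rwa [e1, e2] at h
  set E : ℝ≥0∞ := (P HCr)⁻¹ * Q with hEdef
  have hfinE : E ≠ ∞ := ne_top_of_le_ne_top ENNReal.ofReal_ne_top hup'
  constructor
  · have := ENNReal.toReal_mono ENNReal.ofReal_ne_top hup'
    rwa [ENNReal.toReal_ofReal hz] at this
  · have h2 : z ≤ E.toReal + z * (8 * z) := by
      have h3 := ENNReal.toReal_mono (ENNReal.add_ne_top.2
        ⟨hfinE, ENNReal.mul_ne_top ENNReal.ofReal_ne_top ENNReal.ofReal_ne_top⟩) hlow'
      rwa [ENNReal.toReal_ofReal hz, ENNReal.toReal_add hfinE (ENNReal.mul_ne_top ENNReal.ofReal_ne_top ENNReal.ofReal_ne_top),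
        ENNReal.toReal_mul (a := ENNReal.ofReal z) (b := ENNReal.ofReal (8 * z)), ENNReal.toReal_ofReal hz,
        ENNReal.toReal_ofReal (by positivity)] at h3
    nlinarith

end Mecke

/-! ### The density of a low-activity state: limit of the free finite-volume densities; bounds -/

/-- The density of a finite law carried by hard-sphere configurations, as a real finite sum.
[folklore] -/
theorem density_toReal_eq_sum {μ : Measure (PointConfig Phase)} [IsFiniteMeasure μ]
    (hμ : ∀ᵐ ω ∂μ, HardSphere.IsHardCore 1 ω) :
    (PointProcess.density μ).toReal = ∑ m ∈ Finset.range 9, (m : ℝ) * μ.real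
      {c : PointConfig Phase | c.count (Prod.fst ⁻¹' (Torus.unitCube (Fin 3) : Set Pos)) = m} := by
  rw [density_eq_sum hμ, ENNReal.toReal_sum (fun m _ =>
    ENNReal.mul_ne_top (ENNReal.natCast_ne_top _) (measure_ne_top _ _))]
  refine Finset.sum_congr rfl fun m _ => ?_
  rw [ENNReal.toReal_mul, ENNReal.toReal_natCast, measureReal_def]

/-- The density of a finite law carried by hard-sphere configurations is finite. [folklore] -/
theorem density_ne_top {μ : Measure (PointConfig Phase)} [IsFiniteMeasure μ]
    (hμ : ∀ᵐ ω ∂μ, HardSphere.IsHardCore 1 ω) : PointProcess.density μ ≠ ∞ := by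
  rw [density_eq_sum hμ]
  exact ENNReal.sum_ne_top.2 fun m _ => ENNReal.mul_ne_top (ENNReal.natCast_ne_top _) (measure_ne_top _ _)

/-- The free finite-volume distribution is a finite measure. [folklore] -/
theorem isFiniteMeasure_hsLocalSpec (σ : ℝ) (ν : Measure Phase) (Λ : Set Pos) (η : PointConfig Phase) :
    IsFiniteMeasure (hsLocalSpec σ ν Λ η) :=
  ⟨lt_of_le_of_lt (hsLocalSpec_apply_univ_le_one σ ν Λ η) ENNReal.one_lt_top⟩

/-- **First-order bounds on the density of a low-activity DLR state**: for `0 ≤ z ≤ 1/32` and any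
solution `μ` of the DLR equations of `(1, z · Leb ⊗ M)` (probability marks),
`z - 8z² ≤ ρ(μ) ≤ z` — the density is the limit of the free finite-volume densities along the balls
`B(0, d + 4)` (pinning of the layer probabilities), which obey the bounds
(`lintegral_count_hsLocalSpec_empty_bounds`). [cite: Ruelle1969, §4.2 (2.5), (2.35) and §4.3 (3.12)] -/
theorem density_toReal_bounds {z : ℝ} (hz : 0 ≤ z) (hz1 : z ≤ 1 / 32) (M : Measure Pos) [IsProbabilityMeasure M]
    {μ : Measure (PointConfig Phase)} (hμ : IsHsLocalGibbs 1 ((Real.toNNReal z) • ((volume : Measure Pos).prod M)) μ) :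
    z - 8 * z ^ 2 ≤ (PointProcess.density μ).toReal ∧ (PointProcess.density μ).toReal ≤ z := by
  haveI := hμ.isProbabilityMeasure
  set ν : Measure Phase := (Real.toNNReal z) • ((volume : Measure Pos).prod M) with hν
  set A : ℕ → Set (PointConfig Phase) := fun m =>
    {c | c.count (Prod.fst ⁻¹' (Torus.unitCube (Fin 3) : Set Pos)) = (m : ℕ∞)} with hA
  set γ : ℕ → Measure (PointConfig Phase) := fun d =>
    hsLocalSpec 1 ν (Metric.ball 0 (((2 : ℕ) : ℝ) + ((d : ℝ) + 2) * 1)) ∅ with hγ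
  haveI : ∀ d, IsFiniteMeasure (γ d) := fun d => isFiniteMeasure_hsLocalSpec 1 ν _ ∅
  -- densities as finite sums of layer probabilities
  have hμsum : (PointProcess.density μ).toReal = ∑ m ∈ Finset.range 9, (m : ℝ) * μ.real (A m) :=
    density_toReal_eq_sum hμ.ae_isHardCore
  have hγsum : ∀ d, (PointProcess.density (γ d)).toReal = ∑ m ∈ Finset.range 9, (m : ℝ) * (γ d).real (A m) :=
    fun d => density_toReal_eq_sum (hsLocalSpec_ae_isHardCore ν 1 _ ∅)
  -- layerwise convergence by pinning
  have htend : ∀ m : ℕ, Tendsto (fun d => (γ d).real (A m)) atTop (𝓝 (μ.real (A m))) := by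
    intro m
    have hb : ∀ d, |(γ d).real (A m) - μ.real (A m)| ≤ 4 * Real.exp 2 * (1 / 2 : ℝ) ^ d := fun d => by
      rw [abs_sub_comm]; exact abs_measureReal_layer_sub_le hz hz1 M hμ m d
    have h0 : Tendsto (fun d : ℕ => 4 * Real.exp 2 * (1 / 2 : ℝ) ^ d) atTop (𝓝 0) := by
      have h := (tendsto_pow_atTop_nhds_zero_of_lt_one (by norm_num : (0 : ℝ) ≤ 1 / 2)
        (by norm_num : (1 / 2 : ℝ) < 1)).const_mul (4 * Real.exp 2)
      rwa [mul_zero] at h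
    have h1 : Tendsto (fun d => (γ d).real (A m) - μ.real (A m)) atTop (𝓝 0) :=
      squeeze_zero_norm (fun d => by rw [Real.norm_eq_abs]; exact hb d) h0
    rwa [tendsto_sub_nhds_zero_iff] at h1
  have hlim : Tendsto (fun d => (PointProcess.density (γ d)).toReal) atTop (𝓝 (PointProcess.density μ).toReal) := by
    rw [hμsum]
    simp_rw [hγsum]
    exact tendsto_finsetSum _ fun m _ => (htend m).const_mul _
  -- the finite-volume bounds
  have hbounds : ∀ d, (PointProcess.density (γ d)).toReal ≤ z ∧ z - 8 * z ^ 2 ≤ (PointProcess.density (γ d)).toReal := by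
    intro d
    have hC : (Torus.unitCube (Fin 3) : Set Pos) ⊆ Metric.ball 0 (((2 : ℕ) : ℝ) + ((d : ℝ) + 2) * 1) :=
      torusUnitCube_subset_ball.trans (Metric.ball_subset_ball (by push_cast; nlinarith [d.cast_nonneg (α := ℝ)]))
    exact lintegral_count_hsLocalSpec_empty_bounds hz M Metric.isOpen_ball.measurableSet Metric.isBounded_ball hC
  exact ⟨ge_of_tendsto' hlim fun d => (hbounds d).2, le_of_tendsto' hlim fun d => (hbounds d).1⟩

end Density

/-! ## Part V — the discharge -/

/-- **The dilute hard-sphere gas** (discharge of `RuelleDiluteHardSphereGas`): with `z₁ = 1/32`,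
`C = 8` and `ρ(z)` the density of the unique DLR state of the unit-diameter hard-sphere gas at
activity `z` (reference Maxwellian marks `β = 1`, `u = 0`), `ρ` is continuous on `(0, z₁)` with
`z - 8z² ≤ ρ(z) ≤ z`, and for every `β > 0`, `u ∈ ℝ³`, `0 < z < z₁` the image of that state under
the velocity map `(q, v) ↦ (q, u + β^{-1/2} v)` is a translation-invariant hard-sphere Gibbs state
`IsHardSphereGibbs 1 z β u` of density `ρ(z)`.  Ingredients: existence, uniqueness (translation
invariance) and pinning of DLR states at small activity (the tree's Michelen–Perkins route,
`RiemannLocalGibbs*`), the Janossy formula identifying the two finite-volume specifications, the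
Mecke equation for the first-order density bounds, and velocity transport of Poisson laws.
Sources as printed: Ruelle 1969 Thm 4.2.3 and §4.3 (existence, density `ρ₁ = z + O(z²)`,
`ρ₁ ≤ z`); Dobrushin–Sinai–Sukhov Ch. 10 §2.4–2.5 (DLR, translation invariance, Maxwellian momenta).
[cite: Ruelle1969, §4.2 Thm 4.2.3; §4.3 Thm 4.3.1 and eq. (3.12)] -/
theorem RuelleDiluteHardSphereGas_holds : RuelleDiluteHardSphereGas := by
  -- the reference mark law `M₁(v) dv` and the reference states
  set M₀ : Measure Pos := (volume : Measure Pos).withDensity fun v => ENNReal.ofReal (maxwellianBeta 1 (v - 0)) with hM₀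
  haveI : IsProbabilityMeasure M₀ := isProbabilityMeasure_withDensity_maxwellianBeta one_pos 0
  set ν₀ : ℝ → Measure Phase := fun z => (Real.toNNReal z) • ((volume : Measure Pos).prod M₀) with hν₀
  set G₀ : ℝ → Measure (PointConfig Phase) := fun z => hsLocalGibbsState 1 (ν₀ z) with hG₀def
  have hG₀ : ∀ z ∈ Icc (0 : ℝ) (1 / 32), IsHsLocalGibbs 1 (ν₀ z) (G₀ z) ∧ IsHardSphereGibbs 1 z 1 0 (G₀ z) ∧
      HardSphere.IsTranslationInvariant (G₀ z) := fun z hz =>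
    hsLocalGibbsState_isHardSphereGibbs hz.1 (by linarith [hz.2]) one_pos 0
  refine ⟨1 / 32, 8, by norm_num, by norm_num, fun z => (PointProcess.density (G₀ z)).toReal, ?_, ?_, ?_⟩
  · -- continuity of the density on `(0, z₁)`
    exact (continuousOn_density_toReal M₀ G₀ fun z hz => (hG₀ z hz).1).mono Ioo_subset_Icc_self
  · -- the first-order bounds
    intro z hz0 hz1
    have h := density_toReal_bounds hz0.le hz1.le M₀ (hG₀ z ⟨hz0.le, hz1.le⟩).1
    exact ⟨h.1, h.2⟩
  · -- the states, by velocity transport of the reference state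
    intro β hβ u z hz0 hz1
    obtain ⟨φ, hφ⟩ := exists_homeomorph_map_withDensity_maxwellianBeta hβ u
    set Φ : Phase ≃ₜ Phase := (Homeomorph.refl Pos).prodCongr φ with hΦdef
    have hΦ : ∀ p, (Φ p).1 = p.1 := fun p => rfl
    obtain ⟨hDLR, -, hT⟩ := hG₀ z ⟨hz0.le, hz1.le⟩
    haveI := hDLR.isProbabilityMeasure
    refine ⟨(G₀ z).map (PointConfig.mapHomeomorph Φ), ?_, ?_, ?_⟩
    · -- DLR equations in the `FluidPDE` sense
      haveI : IsProbabilityMeasure ((volume : Measure Pos).withDensity fun v => ENNReal.ofReal (maxwellianBeta β (v - u))) :=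
        isProbabilityMeasure_withDensity_maxwellianBeta hβ u
      have hmap : (ν₀ z).map Φ = (Real.toNNReal z) • ((volume : Measure Pos).prod
          ((volume : Measure Pos).withDensity fun v => ENNReal.ofReal (maxwellianBeta β (v - u)))) := by
        simp only [hν₀]
        rw [hΦdef, smul_prod_map_prodCongr, hφ]
      haveI : IsLocallyFiniteMeasure (ν₀ z) := by simp only [hν₀]; infer_instance
      haveI : IsLocallyFiniteMeasure ((ν₀ z).map Φ) := by rw [hmap]; infer_instance
      have h := IsHsLocalGibbs.map_mapHomeomorph Φ hΦ (smul_prod_singleton z M₀) hDLR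
      rw [hmap] at h
      exact isHardSphereGibbs_of_isHsLocalGibbs u hz0.le hβ h
    · -- translation invariance
      exact fun a => isTranslationInvariant_map_mapHomeomorph φ hT a
    · -- the density
      rw [density_map_mapHomeomorph Φ hΦ, ENNReal.ofReal_toReal (density_ne_top hDLR.ae_isHardCore)]

end Literature.MathematicalPhysics.StatisticalMechanics

end
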